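import Summits.Parity.GeneralizedHardyLittlewood.Theses.LiouvilleShiftedTables
import Summits.Parity.GeneralizedHardyLittlewood.Theorems.LiouvilleShiftedTablesDilatedTableChowlaStubSmallConductors
import Summits.Parity.GeneralizedHardyLittlewood.Theorems.LiouvilleShiftedTablesDilatedTableChowlaStubFewBadConductors
import Summits.Parity.GeneralizedHardyLittlewood.Theorems.LiouvilleShiftedTablesDilatedTableChowlaStubOnePointTransfer
import Summits.Parity.GeneralizedHardyLittlewood.Theorems.LiouvilleShiftedTablesDilatedTableChowlaGenericCore
import Summits.Parity.GeneralizedHardyLittlewood.Theorems.LiouvilleShiftedTablesLargeDilatedTableChowla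
import Summits.Parity.GeneralizedHardyLittlewood.Theorems.LiouvilleShiftedTablesLargeDilatedTableChowlaPointwise

/-!
# Skeleton line `positivity-quarantine` for crux `DilatedTableChowla` (stmt-Parity-14271)

## Lead c1 reshape (2026-08-16, prover-line-stmt-Parity-14271-c1-0) — READ THIS FIRST

State inherited from lead -0 and the tree: (Z1) `stub_smallConductors` LANDED p74001, (Z2)
`stub_fewBadConductors` LANDED p74249, (★) `stub_onePointTransfer` LANDED p82378 (all imported below,
so §5's first three stubs are now THEOREMS, no `sorry`); (C⁺) `stub_genericAffineTable` was certified
crux-EQUIVALENT (`GenericCore.genericAffineTable_of_dilatedTableChowla`, p84650).  Since then the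
planner's unused-crux repair FILED the residual of the crux beyond its `q = 1` slice as ledger items:
`LargeDilatedTableChowla` (stmt-Parity-14839, the band `(log x)^K < q ≤ x^{δ/2}`, `∃ K`) and the glue
`TableToDilated` (stmt-Parity-14840, CLOSED: `Theorems.tableToDilated_proof`), and
`LargeDilatedTableChowla.dilatedTableChowla_iff_table_and_item :
DilatedTableChowla ↔ TableChowla ∧ LargeDilatedTableChowla` is kernel-checked (p88402).

RESHAPE: the open stub (C⁺) is therefore split AT THE SKELETON LEVEL into the two registered stubs
* `stub_tableChowla : TableChowla` — verbatim the sibling crux stmt-Parity-14270 (its own chain);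
* `stub_largeDilatedTableChowla : LargeDilatedTableChowla` — verbatim the support item stmt-Parity-14839;
and (C⁺) becomes the THEOREM `genericAffineTable_of_stubs` (§5c): small dilations `q ≤ (log x)^{K₀}`
from `stub_tableChowla` by positivity (`GenericCore.genericAffineTable_of_tableChowla_of_largeDilations`),
the band from `stub_largeDilatedTableChowla` by Markov on the harmonic average
(`LargeDilatedTableChowla.item_imp_bandPointwise`); the one-point hypothesis of (C⁺) is discharged by
the composition below but is IDLE in the band (a `(log x)^B`-saving character-sum bound carries no
information on classes to moduli `q > (log x)^B`).  `DilatedTableChowla_of` is unchanged: the line's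
own quarantine composition `lhs_bound_of`, now with exactly TWO `sorry`s, both verbatim ledger items.
The direct composition through the landed glue is recorded as an `example`
(`LargeDilatedTableChowla.dilatedTableChowla_of_table_of_item`).  So this line has no content of its
own left: everything it could supply — (Z1), (Z2), (★), lever (P), the harmonic quarantine, and the
composition `GenericAffineTable → DilatedTableChowla` (landed by lead c1 as
`Theorems/LiouvilleShiftedTablesDilatedTableChowlaQuarantine*.lean`) — is in the tree, and the crux
hinges on stmt-Parity-14270 ∧ stmt-Parity-14839.

## Original header (planner, lead -0)

Route `LiouvilleShiftedTables` (X1, rank 3), crux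
`Summit.Parity.GeneralizedHardyLittlewood.Theses.LiouvilleShiftedTables.DilatedTableChowla`:
for every `c ≠ 0`, `0 < δ ≤ 1/12`, `C > 0`, all large `x`, uniformly for `x^δ ≤ A ≤ x^{1/3+δ}` and all
class functions `u, v : ℕ → ℕ`,
`Σ_{q ≤ x^{δ/2}} q³ · Σ_{a,a' ∼ A, a≡a'≡u(q) (q)} (Σ_{b ≤ x/A, b≡v(q) (q)} λ(ab+c)λ(a'b+c))² ≤ x²/(log x)^C`
— in the notation of §0 (verbatim Disproof §0): `lhs c δ x A u v ≤ x²/(log x)^C`; trivial size of a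
block `F(q,u,v)` is `36 x²/q⁴`, so the weight `q³` is the HARMONIC weight `1/q`.

## The line (idea `positivity-quarantine`, crux-ideate r1 ideator 3; triage r1: 3 × pass)

QUARANTINE ARCHITECTURE (Gallagher–Linnik division of labour, made finite and kernel-checked):
a dilation `q` is BOX-GENERIC (`BoxGeneric`, §1) when no Dirichlet character to a modulus `q·m`,
`m ≤ (log x)^κ` (MIXED conductors — triage r1-1/r1-3 sharpening 2), has an `L`-zero in the Linnik box
`σ > 1 − K' log log x/log x`, `|t| ≤ (log x)^{K''}` (POLYLOG height — triage r1-2 sharpening 2).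
* (Z1) `stub_smallConductors`: every modulus `≤ (log x)^K` is box-zero-free (classical zero-free
  region + Siegel; all inputs PROVED in the tree).
* (Z2) `stub_fewBadConductors`: the bad moduli `≤ x^θ` are the multiples of `≤ (log x)^{E₀}` bad ones
  (Bombieri's log-free density theorem, PROVED in the tree as `LogFreeDensity.logFreeDensity_dirichlet`).
* HARMONIC QUARANTINE (§4, proved here): hence the non-generic `q ≤ x^{δ/2}` have harmonic mass
  `≤ (log x)^{E₀+2κ+1−K}` — the gcd trick `t = gcd(s,q) ∣ q`, `s/t ∣ m` localises a bad conductor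
  `s ∣ q·m` to a divisor `t ≥ s/(log x)^κ` of `q` (this is the "aperiodicity uniform in conductors"
  certificate Disproof §7 demands, localised to the divisors of `q`; the quarantined `q` are exactly
  the multiples of Siegel-type conductors `> (log x)^K`, whose blocks ARE biased).
* (★) `stub_onePointTransfer`: box-genericity of `q ≤ x^{1/24}` ⟹ ONE-POINT DATA at `q`
  (`OnePointData`: `(log x)^B`-saving character sums `Σ_{k≤y} λ(k)χ(k)`, `χ mod q·m`, `x^{1/2} ≤ y ≤ x²`)
  — the statement (★) triage r1-3 asked to be filed first; Perron + Borel–Carathéodory for `1/L`.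
* (C⁺) `stub_genericAffineTable` (HARDEST): at every dilation carrying the one-point data, outside a
  harmonically sparse set `E'` of the prover's choosing, the POINTWISE bound
  `q⁴ F(q, u q, v q) ≤ x²/(log x)^C` — "affine `TableChowla` at generic `q`", the card's transfer, cut
  at the one-point interface so that no `L`-function enters it, and stated in the §10 shape so that
  it stays crux-implied up to logs (Disproof §11; triage r1-2 (3), r1-3 (4)).  Its `q = 1` case is
  `TableChowla` (stmt-Parity-14270): the line RELOCATES the two-point content, it does not claim to
  reduce it; what it removes, provably, is everything else (dilations, class-sup bookkeeping,
  exceptional moduli, Landau–Siegel).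
* `DilatedTableChowla_of` (§6, no `sorry` of its own) composes the four stubs into the crux BY NAME
  through `lhs_bound_of` (Disproof §10's summation with `E ∪ E'`, `log x ≥ 5`).
* §7 records lever (P) of the card (positivity along the divisor lattice, `F_le_of_dvd`), sorry-free;
  it is a tool for the (C⁺) prover, no longer a load-bearing step.

## Disproof used (`Cruxes/DilatedTableChowla/Disproof.lean`, cdisprove g2 v4, 1973 lines, rc 0)
* §4 `false_without_shift_ne_zero`, `false_without_delta_pos`, `false_without_delta_le`,
  `false_without_lower_window`, `false_without_upper_window` — HONOURED: every load-bearing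
  hypothesis (`c ≠ 0`, `0 < δ ≤ 1/12`, the window) is carried VERBATIM by `stub_genericAffineTable`
  and used there only ("the line uses H at stub_genericAffineTable"); (Z1), (Z2), (★) are `λ`-table
  free and `c`-blind, as the card promised ((P),(Q) are c-blind bookkeeping). `withoutCPos_of_crux`:
  `0 < C` is decoration — (C⁺) keeps it only to match the crux.
* §6 tightness (`false_with_lower_window_halved`, `false_with_dilations_to_delta`,
  `false_with_weight_four`) — RESPECTED: (C⁺) keeps `q ≤ ⌊x^{δ/2}⌋`, so blocks keep `≥ √A` rows and
  the pointwise target `x²/(q⁴(log x)^C)` stays above the block diagonal `≍ x²/(q³A)` (`qL^C ≤ A`).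
* §7 `not_dilatedTableChowlaFor_periodic` — the periodic pretenders are exactly the quarantined
  configurations (conductor dividing `q`); for generic `q` the one-point data excludes them.
* §9 `crux_iff_offDiagonal` — (C⁺) bounds `F` (diagonal included; it is negligible, see above).
* §10 `crux_of_pointwiseOffExceptional` — the composition IS §10 with the exceptional set NAMED
  (`excSet ∪ E'`) and its harmonic mass PROVED small from (Z1)+(Z2); §14 `sum_inv_multiples_le`
  reproduced and summed over the cover set.
* §11 `crux_imp_pointwise_markov` — why (C⁺) is stated off a sparse `E'`: it is then implied by the
  crux up to powers of `log x`, i.e. not a strict strengthening.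
* §12 `S_eq_twoPoint`, §13 `x0_large` — pointers for the (C⁺) prover (two-point form; numerics see
  only the diagonal).
* No `Negative/` lemma has landed for THIS crux.  Checked against the sibling crux's landed
  `Theorems/TableChowla/Negative/*` (stmt-Parity-14270): `not_tableChowlaWithoutShiftNeZero`,
  `not_tableChowlaWithout{Lower,Upper}Window`, `not_tableChowlaWithoutDelta{Pos,Le}` refute only
  hypothesis-dropped shapes, all of whose hypotheses (C⁺) keeps; `tableChowla_iff_fewBadPairs`,
  `tableChowla_of_uniformBinaryChowla`, `tableChowla_of_nearDiagonal` are tools that run verbatim on a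
  block `(q;u,v)`.  `ledger negatives --problem Parity` = {14832, 9541, 4218}: no stub is an instance
  (4218's unbounded `δ`-window is excluded by `δ ≤ 1/12` in (C⁺)).
-/

noncomputable section

namespace Summit.Parity.GeneralizedHardyLittlewood.Cruxes.DilatedTableChowla.PositivityQuarantine

open Summit.Parity.GeneralizedHardyLittlewood.Theses.LiouvilleShiftedTables
open Finset
open scoped Classical

/-! ### §0 The crux, factored (verbatim `Disproof.lean` §0, cdisprove g2 v4) -/

/-- `L n = λ(n.toNat)` as a real number (`0` for `n ≤ 0`). -/
def L (n : ℤ) : ℝ := (ArithmeticFunction.liouville (Int.toNat n) : ℝ)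

/-- Rows of the `(q;u)`-block at scale `A`: `a ∈ (⌊A⌋, ⌊2A⌋]`, `a ≡ u (mod q)`. -/
def rows (A : ℝ) (q u : ℕ) : Finset ℕ :=
  (Finset.Ioc ⌊A⌋₊ ⌊2 * A⌋₊).filter (fun a : ℕ => a ≡ u [MOD q])

/-- Columns: `b ∈ [1, ⌊x/A⌋]`, `b ≡ v (mod q)`. -/
def cols (x A : ℝ) (q v : ℕ) : Finset ℕ :=
  (Finset.Icc 1 ⌊x / A⌋₊).filter (fun b : ℕ => b ≡ v [MOD q])

/-- `S(a,a') = Σ_{b ∈ cols} λ(ab+c) λ(a'b+c)` (an entry of the block Gram matrix `M Mᵀ`). -/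
def S (c : ℤ) (x A : ℝ) (q v a a' : ℕ) : ℝ :=
  ∑ b ∈ cols x A q v, L ((a : ℤ) * b + c) * L ((a' : ℤ) * b + c)

/-- The block fourth moment `F(q,u,v) = tr (M Mᵀ)² = Σ_{a,a' ∈ rows} S(a,a')²`. -/
def F (c : ℤ) (x A : ℝ) (q u v : ℕ) : ℝ :=
  ∑ a ∈ rows A q u, ∑ a' ∈ rows A q u, (S c x A q v a a') ^ 2

/-- The left-hand side of the crux: `Σ_{1 ≤ q ≤ ⌊x^{δ/2}⌋} q³ · F(q, u q, v q)`. -/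
def lhs (c : ℤ) (δ x A : ℝ) (u v : ℕ → ℕ) : ℝ :=
  ∑ q ∈ Finset.Icc 1 ⌊x ^ (δ / 2)⌋₊, (q : ℝ) ^ 3 * F c x A q (u q) (v q)

/-- The crux in the factored notation (definitional). -/
theorem crux_iff_lhs : DilatedTableChowla ↔
    ∀ c : ℤ, c ≠ 0 → ∀ δ : ℝ, 0 < δ → δ ≤ 1 / 12 → ∀ C : ℝ, 0 < C → ∃ x₀ : ℝ, ∀ x : ℝ, x₀ ≤ x →
      ∀ A : ℝ, x ^ δ ≤ A → A ≤ x ^ (1 / 3 + δ) → ∀ u v : ℕ → ℕ,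
        lhs c δ x A u v ≤ x ^ 2 / Real.log x ^ C :=
  Iff.rfl

/-! ### §1 Linnik boxes, box-genericity of a dilation, one-point data -/

/-- Lower edge of the Linnik box at scale `x` with width parameter `K'`:
`σ₀(x) = 1 − K' log log x / log x`. -/
def boxEdge (x K' : ℝ) : ℝ := 1 - K' * Real.log (Real.log x) / Real.log x

/-- `BoxZeroFree n x K' H`: no Dirichlet character to the modulus `n` (primitive or not, principal
included — so for `n ≥ 1` this contains `ζ`) has an `L`-zero `s ≠ 1` with `σ₀(x) < re s` and
`|im s| ≤ H`.  Vacuous for `n = 0`. -/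
def BoxZeroFree (n : ℕ) (x K' H : ℝ) : Prop :=
  ∀ [NeZero n], ∀ χ : DirichletCharacter ℂ n, ∀ s : ℂ,
    boxEdge x K' < s.re → |s.im| ≤ H → s ≠ 1 → DirichletCharacter.LFunction χ s ≠ 0

/-- BOX-GENERICITY of a dilation `q` (triage sharpening 2 of r1-1/r1-3: MIXED conductors): every
modulus `n = q·m` with `m ≤ (log x)^κ` is box-zero-free with height `(log x)^{K''}` (triage r1-2
sharpening 2: polylogarithmic height, so that the CLASSICAL zero-free region certifies all small
conductors). -/
def BoxGeneric (q : ℕ) (x K' K'' κ : ℝ) : Prop :=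
  ∀ n : ℕ, q ∣ n → (n : ℝ) ≤ q * Real.log x ^ κ → BoxZeroFree n x K' (Real.log x ^ K'')

/-- ONE-POINT DATA at a dilation `q` (the statement (★) of triage r1-3, sharpening 4, in character
form): every character sum of `λ` to a modulus `n = q·m`, `m ≤ (log x)^κ`, over an initial segment
`[1, y]` with `x^{1/2} ≤ y ≤ x²`, saves `(log x)^B`. For `q = 1` this is Siegel–Walfisz quality
information and is TRUE unconditionally; for `q` a power of `x` it is what box-genericity buys. -/
def OnePointData (q : ℕ) (x B κ : ℝ) : Prop :=
  ∀ n : ℕ, q ∣ n → (n : ℝ) ≤ q * Real.log x ^ κ → ∀ [NeZero n], ∀ χ : DirichletCharacter ℂ n,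
    ∀ y : ℝ, x ^ (1 / 2 : ℝ) ≤ y → y ≤ x ^ 2 →
      ‖∑ k ∈ Finset.Icc 1 ⌊y⌋₊, (ArithmeticFunction.liouville k : ℂ) * χ (k : ZMod n)‖ ≤
        y / Real.log x ^ B

/-! ### §2 The four obligations of the line, as named propositions -/

/-- (Z1) SMALL CONDUCTORS ARE BOX-ZERO-FREE: for all `K, K', K''` and all large `x`, every modulus
`d ≤ (log x)^K` is box-zero-free with height `(log x)^{K''}`.  [Classical zero-free region
`σ > 1 − c/log(d(|t|+4))` (tree: `DirichletZFR.exists_zeroFree`, MV Thm 11.3; for `ζ` the tree's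
classical region) is wider than `K' log log x/log x` when `d, |t| ≤ (log x)^{O(1)}`; the possible
real zero of a quadratic character is `≤ 1 − C(ε) d^{-ε}` (tree: `exists_one_sub_realZero_ge`,
MV Cor. 11.15, Siegel — ineffective, which the `∃ x₀` form tolerates); imprimitive characters via
`DirichletCharacter.LFunction_changeLevel` (extra Euler factors vanish only on `re s = 0`).] -/
def SmallConductorsZeroFree : Prop :=
  ∀ K K' K'' : ℝ, ∃ x₀ : ℝ, ∀ x : ℝ, x₀ ≤ x →
    ∀ d : ℕ, 1 ≤ d → (d : ℝ) ≤ Real.log x ^ K → BoxZeroFree d x K' (Real.log x ^ K'')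

/-- (Z2) FEW BAD CONDUCTORS (grand LOG-FREE zero density): for all `θ, K', K''` there is `E₀` such
that for all large `x` the moduli `d ≤ x^θ` that are NOT box-zero-free are all multiples of a set
`S` of at most `(log x)^{E₀}` bad moduli.  [`S` = the conductors of the primitive characters with a
box zero (plus `1` if `ζ` has one): tree `LogFreeDensity.logFreeDensity_dirichlet` (Bombieri,
*Le grand crible*, Théorème 14) with `P = x^θ`, `α = σ₀(x)`, heights `≤ P⁶`, gives
`#S ≤ 1 + C_D P^{c_D(1−α)} = 1 + C_D (log x)^{c_D θ K'}`; a zero of `L(s,χ)` with `re s > 0` is a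
zero of `L(s,χ*)` for the primitive `χ*` inducing `χ` (`LFunction_changeLevel`).] -/
def FewBadConductors : Prop :=
  ∀ θ K' K'' : ℝ, ∃ E₀ x₀ : ℝ, ∀ x : ℝ, x₀ ≤ x →
    ∃ S : Finset ℕ, (S.card : ℝ) ≤ Real.log x ^ E₀ ∧
      (∀ s ∈ S, ¬ BoxZeroFree s x K' (Real.log x ^ K'')) ∧
      ∀ d : ℕ, 1 ≤ d → (d : ℝ) ≤ x ^ θ → ¬ BoxZeroFree d x K' (Real.log x ^ K'') → ∃ s ∈ S, s ∣ d

/-- (★) ONE-POINT TRANSFER (Linnik's explicit-formula step for `λ`, triage r1-3 sharpenings 3–4):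
for every `B, κ` there are `K', K''` such that for all large `x` and every dilation `q ≤ x^{1/24}`,
box-genericity of `q` implies the one-point data at `q` with saving `(log x)^B`.
[Perron for `Σ λχ n^{-s} = L(2s,χ²)/L(s,χ)` truncated at height `(log x)^{K''}/2`, contour moved to
`σ = 1 − ε K' log log x/log x`; `|1/L(s,χ)| ≤ (log x)^{O(ε K' log(nT)/log x) + O(1)}` inside the box
by Borel–Carathéodory on `log L` (no zeros in the box; `log|L| ≤ (1−σ) log(nT) + O(log log)` from the
approximate formula); moduli `n ≤ x^{1/24}(log x)^κ` against `y ≥ x^{1/2}` leave the margin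
`log y ≥ 10 log(nT)`.  Alternatively via `λ = 1_□ ∗ μ` from the Möbius version (tree machinery of
`SiegelWalfiszMoebius`, `DirichletLFunctionInverseBound`).] -/
def OnePointTransfer : Prop :=
  ∀ B κ : ℝ, 0 < κ → ∃ K' K'' x₀ : ℝ, ∀ x : ℝ, x₀ ≤ x →
    ∀ q : ℕ, 1 ≤ q → (q : ℝ) ≤ x ^ (1 / 24 : ℝ) → BoxGeneric q x K' K'' κ → OnePointData q x B κ

/-- (C⁺) GENERIC AFFINE TABLE-CHOWLA, pointwise off a sparse set, at the ONE-POINT INTERFACE — the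
transfer of the idea card (HARDEST stub).  For every `c ≠ 0`, `0 < δ ≤ 1/12`, `C > 0` there are
`B, κ > 0` such that for all large `x`, all `A` in the window and all class functions `u, v`, outside
an exceptional set `E'` of dilations of harmonic mass `Σ_{q∈E'} 1/q ≤ (log x)^{-C}` (the prover's
choice — it may depend on `x, A, u, v`; this keeps the statement crux-IMPLIED up to powers of `log x`,
Disproof §11 `crux_imp_pointwise_markov`, as triage r1-2 (3) / r1-3 (4) asked), EVERY dilation
`1 ≤ q ≤ x^{δ/2}` that carries the one-point data `OnePointData q x B κ` satisfies the POINTWISE bound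
`q⁴ · F_c(q, u q, v q; A, x) ≤ x²/(log x)^C` — the bound of a plain table of the same dimensions
`(A/q) × (x/(Aq))`.  No `L`-function enters: the `q`-dependent analytic input is exactly the
hypothesis.  At `q = 1` (never in `E'`, whose harmonic mass is `< 1`) the hypothesis holds
unconditionally (Siegel–Walfisz for `λχ`, conductors `≤ (log x)^κ`) and the conclusion is
`TableChowla` (stmt-Parity-14270) at exponent `C`.  The block is the affine table
`λ((u+qi)(v+qj)+c)`; by `S_eq_twoPoint` (Disproof §12) its Gram entries are the two-point sums
`λ(a)λ(a') Σ_{b ≡ v (q)} λ(aa'b + a'c) λ(aa'b + ac)`. -/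
def GenericAffineTable : Prop :=
  ∀ c : ℤ, c ≠ 0 → ∀ δ : ℝ, 0 < δ → δ ≤ 1 / 12 → ∀ C : ℝ, 0 < C → ∃ B κ : ℝ, 0 < κ ∧
    ∃ x₀ : ℝ, ∀ x : ℝ, x₀ ≤ x → ∀ A : ℝ, x ^ δ ≤ A → A ≤ x ^ (1 / 3 + δ) → ∀ u v : ℕ → ℕ,
      ∃ E' : Finset ℕ, (∑ q ∈ E', ((q : ℝ))⁻¹) ≤ (Real.log x ^ C)⁻¹ ∧
        ∀ q : ℕ, 1 ≤ q → q ≤ ⌊x ^ (δ / 2)⌋₊ → q ∉ E' → OnePointData q x B κ →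
          (q : ℝ) ^ 4 *
            (∑ a ∈ (Finset.Ioc ⌊A⌋₊ ⌊2 * A⌋₊).filter (fun a : ℕ => a ≡ u q [MOD q]),
              ∑ a' ∈ (Finset.Ioc ⌊A⌋₊ ⌊2 * A⌋₊).filter (fun a' : ℕ => a' ≡ u q [MOD q]),
                (∑ b ∈ (Finset.Icc 1 ⌊x / A⌋₊).filter (fun b : ℕ => b ≡ v q [MOD q]),
                  (ArithmeticFunction.liouville (Int.toNat ((a : ℤ) * b + c)) : ℝ) *
                    (ArithmeticFunction.liouville (Int.toNat ((a' : ℤ) * b + c)) : ℝ)) ^ 2)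
            ≤ x ^ 2 / Real.log x ^ C

/-- The block expression of `GenericAffineTable` is `F` (definitional). -/
theorem genericAffineTable_iff : GenericAffineTable ↔
    ∀ c : ℤ, c ≠ 0 → ∀ δ : ℝ, 0 < δ → δ ≤ 1 / 12 → ∀ C : ℝ, 0 < C → ∃ B κ : ℝ, 0 < κ ∧
      ∃ x₀ : ℝ, ∀ x : ℝ, x₀ ≤ x → ∀ A : ℝ, x ^ δ ≤ A → A ≤ x ^ (1 / 3 + δ) → ∀ u v : ℕ → ℕ,
        ∃ E' : Finset ℕ, (∑ q ∈ E', ((q : ℝ))⁻¹) ≤ (Real.log x ^ C)⁻¹ ∧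
          ∀ q : ℕ, 1 ≤ q → q ≤ ⌊x ^ (δ / 2)⌋₊ → q ∉ E' → OnePointData q x B κ →
            (q : ℝ) ^ 4 * F c x A q (u q) (v q) ≤ x ^ 2 / Real.log x ^ C :=
  Iff.rfl


/-! ### §3 Elementary bookkeeping (verbatim from `Disproof.lean` §1, §3, §9, §10, §14 — cdisprove g2 v4;
copied because `Cruxes/…` work files are not importable modules) -/

theorem L_nonpos_arg {n : ℤ} (hn : n ≤ 0) : L n = 0 := by
  unfold L
  have : n.toNat = 0 := by omega
  rw [this]; simp

theorem toNat_ne_zero_of_pos {n : ℤ} (hn : 0 < n) : n.toNat ≠ 0 := by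
  omega

theorem L_of_pos {n : ℤ} (hn : 0 < n) :
    L n = (-1 : ℝ) ^ (ArithmeticFunction.cardFactors n.toNat) := by
  unfold L
  rw [ArithmeticFunction.liouville_apply (toNat_ne_zero_of_pos hn)]
  push_cast
  rfl

theorem abs_L_le_one (n : ℤ) : |L n| ≤ 1 := by
  rcases le_or_gt n 0 with h | h
  · rw [L_nonpos_arg h]; simp
  · rw [L_of_pos h]; simp

/-- `|S(a,a')| ≤ #cols`. -/
theorem abs_S_le (c : ℤ) (x A : ℝ) (q v a a' : ℕ) :
    |S c x A q v a a'| ≤ ((cols x A q v).card : ℝ) := by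
  unfold S
  calc |∑ b ∈ cols x A q v, L ((a : ℤ) * b + c) * L ((a' : ℤ) * b + c)|
        ≤ ∑ b ∈ cols x A q v, |L ((a : ℤ) * b + c) * L ((a' : ℤ) * b + c)| :=
          Finset.abs_sum_le_sum_abs _ _
    _ ≤ ∑ b ∈ cols x A q v, (1 : ℝ) := by
          refine Finset.sum_le_sum fun b _ => ?_
          rw [abs_mul]
          have h1 := abs_L_le_one ((a : ℤ) * b + c)
          have h2 := abs_L_le_one ((a' : ℤ) * b + c)
          have h3 := abs_nonneg (L ((a : ℤ) * b + c))
          nlinarith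
    _ = ((cols x A q v).card : ℝ) := by simp

theorem S_sq_le (c : ℤ) (x A : ℝ) (q v a a' : ℕ) :
    (S c x A q v a a') ^ 2 ≤ ((cols x A q v).card : ℝ) ^ 2 := by
  have h := abs_S_le c x A q v a a'
  have h0 : 0 ≤ |S c x A q v a a'| := abs_nonneg _
  calc (S c x A q v a a') ^ 2 = |S c x A q v a a'| ^ 2 := (sq_abs _).symm
    _ ≤ ((cols x A q v).card : ℝ) ^ 2 := by gcongr

theorem F_nonneg (c : ℤ) (x A : ℝ) (q u v : ℕ) : 0 ≤ F c x A q u v :=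
  Finset.sum_nonneg fun _ _ => Finset.sum_nonneg fun _ _ => sq_nonneg _

theorem term_nonneg (c : ℤ) (x A : ℝ) (q u v : ℕ) : 0 ≤ (q : ℝ) ^ 3 * F c x A q u v :=
  mul_nonneg (by positivity) (F_nonneg c x A q u v)

/-- Trivial bound: `F ≤ #rows² #cols²`. -/
theorem F_le_trivial (c : ℤ) (x A : ℝ) (q u v : ℕ) :
    F c x A q u v ≤ ((rows A q u).card : ℝ) ^ 2 * ((cols x A q v).card : ℝ) ^ 2 := by
  unfold F
  calc ∑ a ∈ rows A q u, ∑ a' ∈ rows A q u, (S c x A q v a a') ^ 2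
        ≤ ∑ a ∈ rows A q u, ∑ a' ∈ rows A q u, ((cols x A q v).card : ℝ) ^ 2 :=
          Finset.sum_le_sum fun a _ => Finset.sum_le_sum fun a' _ => S_sq_le c x A q v a a'
    _ = _ := by simp; ring

/-- Two-sided real bounds for the number of `n ∈ (L, M]` in a residue class mod `q`. -/
theorem card_modEq_Ioc_bounds (L M q v : ℕ) (hq : 0 < q) (hLM : L ≤ M) :
    ((M : ℝ) - L) / q - 1 ≤ (((Finset.Ioc L M).filter (fun n : ℕ => n ≡ v [MOD q])).card : ℝ) ∧
    (((Finset.Ioc L M).filter (fun n : ℕ => n ≡ v [MOD q])).card : ℝ) ≤ ((M : ℝ) - L) / q + 1 := by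
  have h := Nat.Ioc_filter_modEq_card L M hq v
  set k := ((Finset.Ioc L M).filter (fun n : ℕ => n ≡ v [MOD q])).card with hk
  have hq' : (0 : ℚ) < q := by exact_mod_cast hq
  have hB1 := Int.floor_le (((M : ℚ) - v) / q)
  have hB2 := Int.lt_floor_add_one (((M : ℚ) - v) / q)
  have hA1 := Int.floor_le (((L : ℚ) - v) / q)
  have hA2 := Int.lt_floor_add_one (((L : ℚ) - v) / q)
  have hdiff : ((M : ℚ) - v) / q - ((L : ℚ) - v) / q = ((M : ℚ) - L) / q := by
    field_simp; ring
  have hLM' : (0 : ℚ) ≤ ((M : ℚ) - L) / q := by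
    apply div_nonneg _ hq'.le
    have : (L : ℚ) ≤ M := by exact_mod_cast hLM
    linarith
  have hkQ : ((M : ℚ) - L) / q - 1 ≤ (k : ℚ) ∧ (k : ℚ) ≤ ((M : ℚ) - L) / q + 1 := by
    have hkZ : (k : ℤ) = max (⌊((M : ℚ) - v) / q⌋ - ⌊((L : ℚ) - v) / q⌋) 0 := h
    constructor
    · have : (⌊((M : ℚ) - v) / q⌋ : ℚ) - ⌊((L : ℚ) - v) / q⌋ ≤ (k : ℚ) := by
        have : ⌊((M : ℚ) - v) / q⌋ - ⌊((L : ℚ) - v) / q⌋ ≤ (k : ℤ) := by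
          rw [hkZ]; exact le_max_left _ _
        exact_mod_cast this
      linarith
    · rcases le_or_gt (⌊((M : ℚ) - v) / q⌋ - ⌊((L : ℚ) - v) / q⌋) 0 with hle | hgt
      · have : (k : ℤ) = 0 := by rw [hkZ]; exact max_eq_right hle
        have hk0 : (k : ℚ) = 0 := by exact_mod_cast this
        rw [hk0]; linarith
      · have : (k : ℤ) = ⌊((M : ℚ) - v) / q⌋ - ⌊((L : ℚ) - v) / q⌋ := by
          rw [hkZ]; exact max_eq_left hgt.le
        have hk1 : (k : ℚ) = (⌊((M : ℚ) - v) / q⌋ : ℚ) - ⌊((L : ℚ) - v) / q⌋ := by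
          exact_mod_cast this
        rw [hk1]; linarith
  constructor
  · have := (Rat.cast_le (K := ℝ)).2 hkQ.1
    push_cast at this
    exact this
  · have := (Rat.cast_le (K := ℝ)).2 hkQ.2
    push_cast at this
    exact this

theorem card_rows_bounds (A : ℝ) (hA : 0 ≤ A) (q u : ℕ) (hq : 0 < q) :
    ((⌊2 * A⌋₊ : ℝ) - ⌊A⌋₊) / q - 1 ≤ ((rows A q u).card : ℝ) ∧
      ((rows A q u).card : ℝ) ≤ ((⌊2 * A⌋₊ : ℝ) - ⌊A⌋₊) / q + 1 := by
  unfold rows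
  exact card_modEq_Ioc_bounds _ _ q u hq (Nat.floor_le_floor (by linarith))

theorem cols_eq_Ioc (x A : ℝ) (q v : ℕ) :
    cols x A q v = (Finset.Ioc 0 ⌊x / A⌋₊).filter (fun b : ℕ => b ≡ v [MOD q]) := by
  unfold cols; rfl

theorem card_cols_bounds (x A : ℝ) (q v : ℕ) (hq : 0 < q) :
    (⌊x / A⌋₊ : ℝ) / q - 1 ≤ ((cols x A q v).card : ℝ) ∧
      ((cols x A q v).card : ℝ) ≤ (⌊x / A⌋₊ : ℝ) / q + 1 := by
  rw [cols_eq_Ioc]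
  have := card_modEq_Ioc_bounds 0 ⌊x / A⌋₊ q v hq (Nat.zero_le _)
  simpa using this

/-- Window bookkeeping: in the crux's range, `1 ≤ q ≤ x^{δ/2} ≤ A`, `A q ≤ x`, hence
`#rows ≤ 3A/q` and `#cols ≤ 2x/(Aq)`. -/
theorem window_counts {δ x A : ℝ} (hδ : 0 < δ) (hδ' : δ ≤ 1 / 12) (hx : 1 ≤ x) (hA1 : x ^ δ ≤ A)
    (hA2 : A ≤ x ^ (1 / 3 + δ)) {q : ℕ} (hq1 : 1 ≤ q) (hq2 : q ≤ ⌊x ^ (δ / 2)⌋₊) (u v : ℕ) :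
    ((rows A q u).card : ℝ) ≤ 3 * A / q ∧ ((cols x A q v).card : ℝ) ≤ 2 * x / (A * q) ∧
      (q : ℝ) ≤ x ^ (δ / 2) ∧ (q : ℝ) ≤ A ∧ A * q ≤ x ∧ 1 ≤ A := by
  have hxpos : 0 < x := by linarith
  have hqpos : (0 : ℝ) < q := by exact_mod_cast hq1
  have hqx : (q : ℝ) ≤ x ^ (δ / 2) := by
    have := Nat.floor_le (Real.rpow_nonneg hxpos.le (δ / 2))
    exact le_trans (by exact_mod_cast hq2) this
  have hxd : x ^ (δ / 2) ≤ x ^ δ := Real.rpow_le_rpow_of_exponent_le hx (by linarith)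
  have h1A : 1 ≤ A := le_trans (Real.one_le_rpow hx hδ.le) hA1
  have hApos : 0 < A := by linarith
  have hqA : (q : ℝ) ≤ A := hqx.trans (hxd.trans hA1)
  have hAq : A * q ≤ x := by
    calc A * q ≤ x ^ (1 / 3 + δ) * x ^ (δ / 2) := by gcongr
      _ = x ^ (1 / 3 + δ + δ / 2) := by rw [← Real.rpow_add hxpos]
      _ ≤ x ^ (1 : ℝ) := Real.rpow_le_rpow_of_exponent_le hx (by linarith)
      _ = x := Real.rpow_one x
  refine ⟨?_, ?_, hqx, hqA, hAq, h1A⟩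
  · have hr := (card_rows_bounds A hApos.le q u hq1).2
    have hfl : ((⌊2 * A⌋₊ : ℝ) - ⌊A⌋₊) ≤ A + 1 := by
      have h1 : (⌊2 * A⌋₊ : ℝ) ≤ 2 * A := Nat.floor_le (by linarith)
      have h2 : A - 1 < (⌊A⌋₊ : ℝ) := by
        have := Nat.lt_floor_add_one A; linarith
      linarith
    have : ((⌊2 * A⌋₊ : ℝ) - ⌊A⌋₊) / q + 1 ≤ 3 * A / q := by
      rw [div_add_one hqpos.ne', div_le_div_iff_of_pos_right hqpos]; linarith
    exact hr.trans this
  · have hc := (card_cols_bounds x A q v hq1).2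
    have hfl : (⌊x / A⌋₊ : ℝ) ≤ x / A := Nat.floor_le (div_nonneg hxpos.le hApos.le)
    have : (⌊x / A⌋₊ : ℝ) / q + 1 ≤ 2 * x / (A * q) := by
      have hAq' : 0 < A * q := by positivity
      rw [div_add_one hqpos.ne', div_le_div_iff₀ hqpos hAq']
      have : (⌊x / A⌋₊ : ℝ) * A ≤ x := by rwa [← le_div_iff₀ hApos]
      nlinarith
    exact hc.trans this

/-- The trivial bound in the window: `q³ F(q,u,v) ≤ 36 x² / q`. -/
theorem term_le_trivial {c : ℤ} {δ x A : ℝ} (hδ : 0 < δ) (hδ' : δ ≤ 1 / 12) (hx : 1 ≤ x)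
    (hA1 : x ^ δ ≤ A) (hA2 : A ≤ x ^ (1 / 3 + δ)) {q : ℕ} (hq1 : 1 ≤ q) (hq2 : q ≤ ⌊x ^ (δ / 2)⌋₊)
    (u v : ℕ) : (q : ℝ) ^ 3 * F c x A q u v ≤ 36 * x ^ 2 * ((q : ℝ))⁻¹ := by
  have hqpos : (0 : ℝ) < q := by exact_mod_cast hq1
  obtain ⟨hr, hcl, -, -, -, h1A⟩ := window_counts hδ hδ' hx hA1 hA2 hq1 hq2 u v
  have hApos : 0 < A := by linarith
  have hF := F_le_trivial c x A q u v
  calc (q : ℝ) ^ 3 * F c x A q u v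
      ≤ (q : ℝ) ^ 3 * ((3 * A / q) ^ 2 * (2 * x / (A * q)) ^ 2) := by
        gcongr
        exact hF.trans (by gcongr)
    _ = 36 * x ^ 2 * ((q : ℝ))⁻¹ := by field_simp; ring

theorem harmonic_Icc_le (Q : ℕ) :
    ∑ q ∈ Finset.Icc 1 Q, ((q : ℝ))⁻¹ ≤ 1 + Real.log Q := by
  have h := harmonic_le_one_add_log Q
  have e : ((harmonic Q : ℚ) : ℝ) = ∑ q ∈ Finset.Icc 1 Q, ((q : ℝ))⁻¹ := by
    rw [harmonic_eq_sum_Icc]; push_cast; rfl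
  linarith [e.symm.le, e.le]

/-- Harmonic mass of the multiples of `q₁` up to `Q` (Disproof §14). -/
theorem sum_inv_multiples_le {q₁ : ℕ} (hq₁ : 1 ≤ q₁) (Q : ℕ) :
    ∑ q ∈ (Finset.Icc 1 Q).filter (fun q => q₁ ∣ q), ((q : ℝ))⁻¹ ≤ (1 + Real.log Q) / q₁ := by
  have hq₁pos : (0 : ℝ) < q₁ := by exact_mod_cast hq₁
  have hsub : (Finset.Icc 1 Q).filter (fun q => q₁ ∣ q) ⊆
      (Finset.Icc 1 (Q / q₁)).image (fun k => k * q₁) := by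
    intro q hq
    obtain ⟨hq, ⟨k, rfl⟩⟩ := Finset.mem_filter.1 hq
    obtain ⟨h1, h2⟩ := Finset.mem_Icc.1 hq
    refine Finset.mem_image.2 ⟨k, Finset.mem_Icc.2 ⟨?_, ?_⟩, by ring⟩
    · rcases Nat.eq_zero_or_pos k with hk | hk
      · subst hk; simp at h1
      · exact hk
    · exact (Nat.le_div_iff_mul_le (by omega)).2 (by simpa [mul_comm] using h2)
  have hinj : Set.InjOn (fun k : ℕ => k * q₁) (Finset.Icc 1 (Q / q₁) : Set ℕ) :=
    fun a _ b _ hab => Nat.eq_of_mul_eq_mul_right (by omega) hab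
  calc ∑ q ∈ (Finset.Icc 1 Q).filter (fun q => q₁ ∣ q), ((q : ℝ))⁻¹
      ≤ ∑ q ∈ (Finset.Icc 1 (Q / q₁)).image (fun k => k * q₁), ((q : ℝ))⁻¹ :=
        Finset.sum_le_sum_of_subset_of_nonneg hsub fun q _ _ => by positivity
    _ = ∑ k ∈ Finset.Icc 1 (Q / q₁), (((k * q₁ : ℕ) : ℝ))⁻¹ := Finset.sum_image hinj
    _ = (∑ k ∈ Finset.Icc 1 (Q / q₁), ((k : ℝ))⁻¹) / q₁ := by
        rw [Finset.sum_div]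
        refine Finset.sum_congr rfl fun k _ => ?_
        push_cast
        rw [mul_inv, div_eq_mul_inv]
    _ ≤ (1 + Real.log ((Q / q₁ : ℕ) : ℝ)) / q₁ := by
        gcongr; exact harmonic_Icc_le (Q / q₁)
    _ ≤ (1 + Real.log Q) / q₁ := by
        apply div_le_div_of_nonneg_right _ hq₁pos.le
        have : Real.log ((Q / q₁ : ℕ) : ℝ) ≤ Real.log Q := by
          rcases Nat.eq_zero_or_pos (Q / q₁) with h0 | hpos
          · rw [h0, Nat.cast_zero, Real.log_zero]; exact Real.log_natCast_nonneg Q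
          · exact Real.log_le_log (by exact_mod_cast hpos) (by exact_mod_cast Nat.div_le_self Q q₁)
        linarith

/-- Eventually `K (log x)^C ≤ x^{ε}`. -/
theorem eventually_log_rpow_le (K C : ℝ) {ε : ℝ} (hε : 0 < ε) :
    ∃ x₁ : ℝ, ∀ x : ℝ, x₁ ≤ x → K * Real.log x ^ C ≤ x ^ ε := by
  rcases le_or_gt K 0 with hK | hK
  · refine ⟨1, fun x hx => ?_⟩
    have h1 : 0 ≤ Real.log x ^ C := Real.rpow_nonneg (Real.log_nonneg hx) C
    have h2 : 0 ≤ x ^ ε := Real.rpow_nonneg (by linarith) ε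
    nlinarith
  · have hlo := isLittleO_log_rpow_rpow_atTop C hε
    have hev := hlo.def (inv_pos.2 hK)
    obtain ⟨x₁, hx₁⟩ := Filter.eventually_atTop.1 hev
    refine ⟨max x₁ 1, fun x hx => ?_⟩
    have hx1 : x₁ ≤ x := le_trans (le_max_left _ _) hx
    have hx1' : 1 ≤ x := le_trans (le_max_right _ _) hx
    have h := hx₁ x hx1
    rw [Real.norm_of_nonneg (Real.rpow_nonneg (Real.log_nonneg hx1') C),
      Real.norm_of_nonneg (Real.rpow_nonneg (by linarith) ε)] at h
    calc K * Real.log x ^ C ≤ K * (K⁻¹ * x ^ ε) := by gcongr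
      _ = x ^ ε := by field_simp

/-- A sum over a `biUnion` of non-negative terms is at most the sum of the sums. -/
theorem sum_biUnion_le_sum (s : Finset ℕ) (t : ℕ → Finset ℕ) (f : ℕ → ℝ) (hf : ∀ i, 0 ≤ f i) :
    ∑ q ∈ s.biUnion t, f q ≤ ∑ i ∈ s, ∑ q ∈ t i, f q := by
  classical
  refine Finset.induction_on s (by simp) ?_
  intro a s ha ih
  rw [Finset.biUnion_insert, Finset.sum_insert ha]
  have hui := Finset.sum_union_inter (s₁ := t a) (s₂ := s.biUnion t) (f := f)
  have hnn : 0 ≤ ∑ q ∈ t a ∩ s.biUnion t, f q := Finset.sum_nonneg fun i _ => hf i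
  linarith

/-! ### §4 Harmonic quarantine: the non-generic dilations are harmonically sparse

The `|S|`-moduli version of Disproof §14 with the GCD TRICK that localises a bad conductor to a
divisor of `q`: if `q` is not box-generic, some modulus `q·m` (`m ≤ (log x)^κ`) has a box zero, hence
(Z2) is a multiple of a bad `s ∈ S`, hence `t := gcd(s, q)` divides `q` with `s/t ∣ m`, i.e.
`t ≥ s/(log x)^κ > (log x)^{K−κ}` by (Z1).  So the exceptional set lies in the multiples of the
`≤ |S| (log x)^κ` moduli `t ∈ coverSet`, each of harmonic mass `≤ (1 + log Q)(log x)^κ/(log x)^K`. -/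

theorem boxZeroFree_zero (x K' H : ℝ) : BoxZeroFree 0 x K' H := by
  intro h; exact absurd rfl h.out

/-- The exceptional set of dilations: the `q ≤ Q` that are not box-generic. -/
def excSet (x K' K'' κ : ℝ) (Q : ℕ) : Finset ℕ :=
  (Finset.Icc 1 Q).filter (fun q => ¬ BoxGeneric q x K' K'' κ)

/-- The quarantine moduli: `t = s / e` with `s ∈ S`, `1 ≤ e ≤ M`, `e ∣ s`. -/
def coverSet (S : Finset ℕ) (M : ℕ) : Finset ℕ :=
  S.biUnion (fun s => ((Finset.Icc 1 M).filter (fun e => e ∣ s)).image (fun e => s / e))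

theorem card_coverSet_le (S : Finset ℕ) (M : ℕ) : (coverSet S M).card ≤ S.card * M := by
  unfold coverSet
  calc (S.biUnion (fun s => ((Finset.Icc 1 M).filter (fun e => e ∣ s)).image (fun e => s / e))).card
      ≤ ∑ s ∈ S, (((Finset.Icc 1 M).filter (fun e => e ∣ s)).image (fun e => s / e)).card :=
        Finset.card_biUnion_le
    _ ≤ ∑ s ∈ S, M := Finset.sum_le_sum fun s _ =>
        Finset.card_image_le.trans ((Finset.card_filter_le _ _).trans (by simp))
    _ = S.card * M := by rw [Finset.sum_const, smul_eq_mul]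

/-- The gcd trick: `s ∣ q m` ⟹ `s = e · t` with `t ∣ q`, `e ∣ s`, `1 ≤ e ≤ m`. -/
theorem exists_cover_dvd {s q m : ℕ} (hs : 1 ≤ s) (hm : 1 ≤ m) (h : s ∣ q * m) :
    ∃ e : ℕ, 1 ≤ e ∧ e ≤ m ∧ e ∣ s ∧ s / e ∣ q := by
  set t := Nat.gcd s q with htdef
  have ht : 0 < t := Nat.gcd_pos_of_pos_left _ hs
  have hts : t ∣ s := Nat.gcd_dvd_left s q
  have htq : t ∣ q := Nat.gcd_dvd_right s q
  have hcop : Nat.Coprime (s / t) (q / t) := Nat.coprime_div_gcd_div_gcd ht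
  have hdvd : s / t ∣ (q / t) * m := by
    have h' : (s / t) * t ∣ ((q / t) * m) * t := by
      have e1 : (s / t) * t = s := Nat.div_mul_cancel hts
      have e2 : ((q / t) * m) * t = q * m := by
        calc ((q / t) * m) * t = (q / t * t) * m := by ring
          _ = q * m := by rw [Nat.div_mul_cancel htq]
      rw [e1, e2]; exact h
    exact Nat.dvd_of_mul_dvd_mul_right ht h'
  have hstm : s / t ∣ m := hcop.dvd_of_dvd_mul_left hdvd
  have hs0 : s ≠ 0 := by omega
  refine ⟨s / t, Nat.div_pos (Nat.le_of_dvd hs hts) ht, Nat.le_of_dvd hm hstm,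
    Nat.div_dvd_of_dvd hts, ?_⟩
  rw [Nat.div_div_self hts hs0]
  exact htq

/-- STRUCTURE of the exceptional set: it is covered by the multiples of `coverSet S ⌊(log x)^κ⌋`. -/
theorem excSet_subset {x θ K' K'' κ : ℝ} {Q : ℕ} {S : Finset ℕ} (hx : 1 ≤ x)
    (hcover : ∀ d : ℕ, 1 ≤ d → (d : ℝ) ≤ x ^ θ → ¬ BoxZeroFree d x K' (Real.log x ^ K'') →
      ∃ s ∈ S, s ∣ d)
    (hQ : (Q : ℝ) * Real.log x ^ κ ≤ x ^ θ) :
    excSet x K' K'' κ Q ⊆ (coverSet S ⌊Real.log x ^ κ⌋₊).biUnion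
      (fun t => (Finset.Icc 1 Q).filter (fun q => t ∣ q)) := by
  intro q hq
  obtain ⟨hqI, hng⟩ := Finset.mem_filter.1 hq
  obtain ⟨hq1, hqQ⟩ := Finset.mem_Icc.1 hqI
  have hqpos : (0 : ℝ) < q := by exact_mod_cast hq1
  have hLk : 0 ≤ Real.log x ^ κ := Real.rpow_nonneg (Real.log_nonneg hx) κ
  unfold BoxGeneric at hng
  push Not at hng
  obtain ⟨n, hqn, hnle, hbad⟩ := hng
  have hn0 : n ≠ 0 := by
    rintro rfl; exact hbad (boxZeroFree_zero x K' _)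
  obtain ⟨m, rfl⟩ := hqn
  have hm1 : 1 ≤ m := by
    rcases Nat.eq_zero_or_pos m with h0 | h0
    · subst h0; simp at hn0
    · exact h0
  have hmle : (m : ℝ) ≤ Real.log x ^ κ := by
    have : (q : ℝ) * m ≤ q * Real.log x ^ κ := by exact_mod_cast hnle
    exact le_of_mul_le_mul_left this hqpos
  have hmM : m ≤ ⌊Real.log x ^ κ⌋₊ := Nat.le_floor hmle
  have hd1 : 1 ≤ q * m := Nat.one_le_iff_ne_zero.2 hn0
  have hdθ : ((q * m : ℕ) : ℝ) ≤ x ^ θ := by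
    push_cast
    calc (q : ℝ) * m ≤ Q * Real.log x ^ κ := by
          have hqQ' : (q : ℝ) ≤ Q := by exact_mod_cast hqQ
          exact mul_le_mul hqQ' hmle (by positivity) (by positivity)
      _ ≤ x ^ θ := hQ
  obtain ⟨s, hsS, hsd⟩ := hcover (q * m) hd1 hdθ hbad
  have hs1 : 1 ≤ s := Nat.pos_of_dvd_of_pos hsd (by omega)
  obtain ⟨e, he1, hem, hes, hsq⟩ := exists_cover_dvd hs1 hm1 hsd
  refine Finset.mem_biUnion.2 ⟨s / e, ?_, Finset.mem_filter.2 ⟨hqI, hsq⟩⟩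
  exact Finset.mem_biUnion.2 ⟨s, hsS, Finset.mem_image.2
    ⟨e, Finset.mem_filter.2 ⟨Finset.mem_Icc.2 ⟨he1, hem.trans hmM⟩, hes⟩, rfl⟩⟩

/-- HARMONIC QUARANTINE: under (Z1) at level `(log x)^K` and (Z2) with the set `S`, the exceptional
dilations `q ≤ Q` (with `Q (log x)^κ ≤ x^θ`) have harmonic mass
`≤ |S| · (log x)^{2κ} (1 + log Q) / (log x)^K`. -/
theorem excSet_harmonic_le {x θ K K' K'' κ : ℝ} {Q : ℕ} {S : Finset ℕ} (hx : 1 < x)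
    (hSbad : ∀ s ∈ S, ¬ BoxZeroFree s x K' (Real.log x ^ K''))
    (hcover : ∀ d : ℕ, 1 ≤ d → (d : ℝ) ≤ x ^ θ → ¬ BoxZeroFree d x K' (Real.log x ^ K'') →
      ∃ s ∈ S, s ∣ d)
    (hsmall : ∀ d : ℕ, 1 ≤ d → (d : ℝ) ≤ Real.log x ^ K → BoxZeroFree d x K' (Real.log x ^ K''))
    (hQ : (Q : ℝ) * Real.log x ^ κ ≤ x ^ θ) :
    ∑ q ∈ excSet x K' K'' κ Q, ((q : ℝ))⁻¹ ≤
      S.card * (Real.log x ^ κ) ^ 2 * (1 + Real.log Q) / Real.log x ^ K := by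
  have hx1 : 1 ≤ x := hx.le
  have hlog : 0 < Real.log x := Real.log_pos hx
  have hLk : 0 ≤ Real.log x ^ κ := Real.rpow_nonneg hlog.le κ
  have hLK : 0 < Real.log x ^ K := Real.rpow_pos_of_pos hlog K
  have hlogQ : 0 ≤ 1 + Real.log Q := by linarith [Real.log_natCast_nonneg Q]
  set M : ℕ := ⌊Real.log x ^ κ⌋₊ with hMdef
  have hMle : (M : ℝ) ≤ Real.log x ^ κ := Nat.floor_le hLk
  -- every quarantine modulus is large: `t = s/e ≥ s/M > (log x)^K / (log x)^κ`
  have hbig : ∀ t ∈ coverSet S M, (1 + Real.log Q) / t ≤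
      (1 + Real.log Q) * Real.log x ^ κ / Real.log x ^ K := by
    intro t ht
    obtain ⟨s, hsS, hts⟩ := Finset.mem_biUnion.1 ht
    obtain ⟨e, he, rfl⟩ := Finset.mem_image.1 hts
    obtain ⟨heI, hes⟩ := Finset.mem_filter.1 he
    obtain ⟨he1, heM⟩ := Finset.mem_Icc.1 heI
    have hs0 : s ≠ 0 := by
      rintro rfl; exact hSbad 0 hsS (boxZeroFree_zero x K' _)
    have hs1 : 1 ≤ s := Nat.one_le_iff_ne_zero.2 hs0
    -- (Z1), contrapositive: a bad modulus exceeds (log x)^K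
    have hsK : Real.log x ^ K < s := by
      by_contra hle
      exact hSbad s hsS (hsmall s hs1 (not_lt.1 hle))
    have hepos : (0 : ℝ) < e := by exact_mod_cast he1
    have hspos : (0 : ℝ) < s := by exact_mod_cast hs1
    have hcast : (((s / e : ℕ)) : ℝ) = (s : ℝ) / e := Nat.cast_div hes hepos.ne'
    have htpos : (0 : ℝ) < (s : ℝ) / e := div_pos hspos hepos
    rw [hcast, div_le_div_iff₀ htpos hLK]
    have heM' : (e : ℝ) ≤ Real.log x ^ κ := le_trans (by exact_mod_cast heM) hMle
    -- (1 + log Q) (log x)^K ≤ (1 + log Q) (log x)^κ · (s/e)  ⟸  e (log x)^K ≤ (log x)^κ s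
    have : Real.log x ^ K * e ≤ Real.log x ^ κ * s := by
      calc Real.log x ^ K * e ≤ s * Real.log x ^ κ := by
            exact mul_le_mul hsK.le heM' hepos.le hspos.le
        _ = Real.log x ^ κ * s := by ring
    calc (1 + Real.log Q) * Real.log x ^ K
        = (1 + Real.log Q) * (Real.log x ^ K * e) / e := by field_simp
      _ ≤ (1 + Real.log Q) * (Real.log x ^ κ * s) / e := by gcongr
      _ = (1 + Real.log Q) * Real.log x ^ κ * (s / e) := by field_simp
  calc ∑ q ∈ excSet x K' K'' κ Q, ((q : ℝ))⁻¹
      ≤ ∑ q ∈ (coverSet S M).biUnion (fun t => (Finset.Icc 1 Q).filter (fun q => t ∣ q)),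
          ((q : ℝ))⁻¹ :=
        Finset.sum_le_sum_of_subset_of_nonneg (excSet_subset hx1 hcover hQ)
          fun q _ _ => by positivity
    _ ≤ ∑ t ∈ coverSet S M, ∑ q ∈ (Finset.Icc 1 Q).filter (fun q => t ∣ q), ((q : ℝ))⁻¹ :=
        sum_biUnion_le_sum _ _ _ fun q => by positivity
    _ ≤ ∑ t ∈ coverSet S M, (1 + Real.log Q) / t := by
        refine Finset.sum_le_sum fun t ht => ?_
        obtain ⟨s, hsS, hts⟩ := Finset.mem_biUnion.1 ht
        obtain ⟨e, he, rfl⟩ := Finset.mem_image.1 hts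
        obtain ⟨heI, hes⟩ := Finset.mem_filter.1 he
        obtain ⟨he1, heM⟩ := Finset.mem_Icc.1 heI
        have hs0 : s ≠ 0 := by
          rintro rfl; exact hSbad 0 hsS (boxZeroFree_zero x K' _)
        have ht1 : 1 ≤ s / e :=
          Nat.div_pos (Nat.le_of_dvd (Nat.one_le_iff_ne_zero.2 hs0) hes) (by omega)
        exact sum_inv_multiples_le ht1 Q
    _ ≤ ∑ t ∈ coverSet S M, (1 + Real.log Q) * Real.log x ^ κ / Real.log x ^ K :=
        Finset.sum_le_sum hbig
    _ = (coverSet S M).card * ((1 + Real.log Q) * Real.log x ^ κ / Real.log x ^ K) := by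
        rw [Finset.sum_const, nsmul_eq_mul]
    _ ≤ (S.card * Real.log x ^ κ) * ((1 + Real.log Q) * Real.log x ^ κ / Real.log x ^ K) := by
        have hcard : ((coverSet S M).card : ℝ) ≤ S.card * Real.log x ^ κ := by
          calc ((coverSet S M).card : ℝ) ≤ ((S.card * M : ℕ) : ℝ) := by
                exact_mod_cast card_coverSet_le S M
            _ = S.card * (M : ℝ) := by push_cast; ring
            _ ≤ S.card * Real.log x ^ κ := by gcongr
        have hnn : 0 ≤ (1 + Real.log Q) * Real.log x ^ κ / Real.log x ^ K :=
          div_nonneg (mul_nonneg hlogQ hLk) hLK.le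
        exact mul_le_mul_of_nonneg_right hcard hnn
    _ = S.card * (Real.log x ^ κ) ^ 2 * (1 + Real.log Q) / Real.log x ^ K := by
        field_simp


/-! ### §5 The line's four obligations: (Z1), (Z2), (★) LANDED; (C⁺) reshaped (lead c1)

(Z1), (Z2), (★) were registered by lead -0 in UNFOLDED, self-contained form and have LANDED as
def-free Theorems files (imported above); here they are theorems by name, no `sorry`.  The bridges
`smallConductorsZeroFree_of_stub`, `fewBadConductors_of_stub`, `onePointTransfer_of_stub` (§5b) recover
the named propositions of §2.  (C⁺) is no longer a stub: §5c derives it from the two REGISTERED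
stubs of this reshape, `stub_tableChowla` and `stub_largeDilatedTableChowla` — the only `sorry`s of
this file, each verbatim a ledger item. -/

/-- (Z1) — small conductors are box-zero-free.  LANDED p74001:
`Theorems.DilatedTableChowla.SmallConductors.stub_smallConductors` (classical zero-free region MV Thm
11.3 + Siegel MV Cor 11.15 + ζ's classical region, all PROVED in the tree). -/
theorem stub_smallConductors :
    ∀ K K' H : ℝ, ∃ x₀ : ℝ, ∀ x : ℝ, x₀ ≤ x →
      ∀ (d : ℕ) [NeZero d] (χ : DirichletCharacter ℂ d) (s : ℂ), (d : ℝ) ≤ Real.log x ^ K →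
        1 - K' * Real.log (Real.log x) / Real.log x < s.re → |s.im| ≤ Real.log x ^ H → s ≠ 1 →
          DirichletCharacter.LFunction χ s ≠ 0 :=
  Summit.Parity.GeneralizedHardyLittlewood.Theorems.DilatedTableChowla.SmallConductors.stub_smallConductors

/-- (Z2) — few bad conductors.  LANDED p74249:
`Theorems.DilatedTableChowla.FewBadConductors.stub_fewBadConductors` (Bombieri's log-free density
theorem `LogFreeDensity.logFreeDensity_dirichlet`, PROVED in the tree). -/
theorem stub_fewBadConductors :
    ∀ θ K' H : ℝ, ∃ E₀ x₀ : ℝ, ∀ x : ℝ, x₀ ≤ x →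
      ∃ S : Finset ℕ, (S.card : ℝ) ≤ Real.log x ^ E₀ ∧
        (∀ s ∈ S, ∃ (_ : NeZero s) (χ : DirichletCharacter ℂ s) (z : ℂ),
            1 - K' * Real.log (Real.log x) / Real.log x < z.re ∧ |z.im| ≤ Real.log x ^ H ∧ z ≠ 1 ∧
              DirichletCharacter.LFunction χ z = 0) ∧
        ∀ (d : ℕ) [NeZero d] (χ : DirichletCharacter ℂ d) (z : ℂ), (d : ℝ) ≤ x ^ θ →
          1 - K' * Real.log (Real.log x) / Real.log x < z.re → |z.im| ≤ Real.log x ^ H → z ≠ 1 →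
            DirichletCharacter.LFunction χ z = 0 → ∃ s ∈ S, s ∣ d :=
  Summit.Parity.GeneralizedHardyLittlewood.Theorems.DilatedTableChowla.FewBadConductors.stub_fewBadConductors

/-- (★) — one-point transfer.  LANDED p82378:
`Theorems.DilatedTableChowla.OnePointTransfer.stub_onePointTransfer` (Perron + contour shift in a
zero-free Linnik box, `1/L` by Borel–Carathéodory, `λ = 𝟙_□ ⋆ μ`; tree
`Literature.NumberTheory.LFunctions.LiouvilleCharSumLinnikBox.norm_sum_le`). -/
theorem stub_onePointTransfer :
    ∀ B κ : ℝ, 0 < κ → ∃ K' H x₀ : ℝ, ∀ x : ℝ, x₀ ≤ x →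
      ∀ q : ℕ, 1 ≤ q → (q : ℝ) ≤ x ^ (1 / 24 : ℝ) →
        (∀ (n : ℕ) [NeZero n] (χ : DirichletCharacter ℂ n) (z : ℂ), q ∣ n →
            (n : ℝ) ≤ q * Real.log x ^ κ → 1 - K' * Real.log (Real.log x) / Real.log x < z.re →
              |z.im| ≤ Real.log x ^ H → z ≠ 1 → DirichletCharacter.LFunction χ z ≠ 0) →
        ∀ (n : ℕ) [NeZero n] (χ : DirichletCharacter ℂ n) (y : ℝ), q ∣ n →
          (n : ℝ) ≤ q * Real.log x ^ κ → x ^ (1 / 2 : ℝ) ≤ y → y ≤ x ^ 2 →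
            ‖∑ k ∈ Finset.Icc 1 ⌊y⌋₊, (ArithmeticFunction.liouville k : ℂ) * χ (k : ZMod n)‖ ≤
              y / Real.log x ^ B :=
  Summit.Parity.GeneralizedHardyLittlewood.Theorems.DilatedTableChowla.OnePointTransfer.stub_onePointTransfer

/-! ### §5a Registered stubs of the c1 reshape (the only two `sorry`s of this file)

Both are VERBATIM ledger items (by name: route decls of `Theses.LiouvilleShiftedTables`).  They are
recorded as stubs so that the skeleton states the crux's exact dependency: by
`LargeDilatedTableChowla.dilatedTableChowla_iff_table_and_item` (p88402) the crux IS their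
conjunction, so no strictly smaller stub set exists inside this line. -/

/-- STUB — the sibling crux `TableChowla` (stmt-Parity-14270, rank 2, its own crux chain): the
`q = 1` table.  It pays for ALL dilations `q ≤ (log x)^{K₀}` (any `K₀`) by positivity of Gram fourth
moments (lever (P), §7 / `Negative.gram_mono`).  Size: open problem (two-point Chowla with a
`(log x)^{-C}` saving averaged over the rank-one family; nearest print MatomakiRadziwillTao2015,
arXiv:1509.05422 Thm 1.2). [cite: MatomakiRadziwillTao2015] -/
theorem stub_tableChowla : TableChowla := by
  sorry

/-- STUB — the support item `LargeDilatedTableChowla` (stmt-Parity-14839): the band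
`(log x)^K < q ≤ x^{δ/2}` of the crux (`∃ K`), i.e. the genuinely `q`-ASPECT two-point content;
prover verdict 2026-08-16T07:50Z: open-problem (no `q`-aspect two-point Matomäki–Radziwiłł theorem in
print; doi:10.1112/plms.12546 is one-point, almost-all `q`).  The line's one-point data (★) is
available at its generic `q` but idle there (`q > (log x)^B`). [cite: doi:10.1112/plms.12546] -/
theorem stub_largeDilatedTableChowla : LargeDilatedTableChowla := by
  sorry

/-! ### §5c (C⁺) from the two registered stubs (lead c1; kernel-checked glue of the tree) -/

/-- The LARGE-DILATION CORE in the shape `GenericCore.genericAffineTable_of_tableChowla_of_largeDilations`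
consumes (threshold `(log x)^{K₀} < q`, pointwise off a harmonically sparse `E'`, one-point data as an
— idle — hypothesis), from `stub_largeDilatedTableChowla` by Markov on the harmonic average
(`LargeDilatedTableChowla.item_imp_bandPointwise`, exponent `2C`): `⌊(log x)^K⌋ < q` follows from
`(log x)^K < q` once `x ≥ 1`. -/
theorem largeDilationsCore_of_stub :
    ∀ c : ℤ, c ≠ 0 → ∀ δ : ℝ, 0 < δ → δ ≤ 1 / 12 → ∀ C : ℝ, 0 < C →
      ∃ K₀ B κ : ℝ, 0 < κ ∧ ∃ x₀ : ℝ, ∀ x : ℝ, x₀ ≤ x → ∀ A : ℝ, x ^ δ ≤ A → A ≤ x ^ (1 / 3 + δ) →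
      ∀ u v : ℕ → ℕ, ∃ E' : Finset ℕ, (∑ q ∈ E', ((q : ℝ))⁻¹) ≤ (Real.log x ^ C)⁻¹ ∧
        ∀ q : ℕ, Real.log x ^ K₀ < q → q ≤ ⌊x ^ (δ / 2)⌋₊ → q ∉ E' →
          (∀ n : ℕ, q ∣ n → (n : ℝ) ≤ q * Real.log x ^ κ → ∀ [NeZero n],
            ∀ χ : DirichletCharacter ℂ n, ∀ y : ℝ, x ^ (1 / 2 : ℝ) ≤ y → y ≤ x ^ 2 →
              ‖∑ k ∈ Finset.Icc 1 ⌊y⌋₊, (ArithmeticFunction.liouville k : ℂ) * χ (k : ZMod n)‖ ≤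
                y / Real.log x ^ B) →
          (q : ℝ) ^ 4 *
            (∑ a ∈ (Finset.Ioc ⌊A⌋₊ ⌊2 * A⌋₊).filter (fun a : ℕ => a ≡ u q [MOD q]),
              ∑ a' ∈ (Finset.Ioc ⌊A⌋₊ ⌊2 * A⌋₊).filter (fun a' : ℕ => a' ≡ u q [MOD q]),
                (∑ b ∈ (Finset.Icc 1 ⌊x / A⌋₊).filter (fun b : ℕ => b ≡ v q [MOD q]),
                  (ArithmeticFunction.liouville (Int.toNat ((a : ℤ) * b + c)) : ℝ) *
                    (ArithmeticFunction.liouville (Int.toNat ((a' : ℤ) * b + c)) : ℝ)) ^ 2)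
            ≤ x ^ 2 / Real.log x ^ C := by
  intro c hc δ hδ hδ' C hC
  obtain ⟨K, x₀, h⟩ :=
    Summit.Parity.GeneralizedHardyLittlewood.Theorems.LargeDilatedTableChowla.item_imp_bandPointwise
      stub_largeDilatedTableChowla c hc δ hδ hδ' C hC
  refine ⟨(K : ℝ), 0, 1, one_pos, max x₀ 1, fun x hx A hA1 hA2 u v => ?_⟩
  have hx₀ : x₀ ≤ x := le_trans (le_max_left _ _) hx
  have hx1 : (1 : ℝ) ≤ x := le_trans (le_max_right _ _) hx
  obtain ⟨E', hE', hpt⟩ := h x hx₀ A hA1 hA2 u v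
  refine ⟨E', hE', fun q hqK hqQ hqE _ => ?_⟩
  have h0 : 0 ≤ Real.log x ^ K := pow_nonneg (Real.log_nonneg hx1) K
  have hqK' : Real.log x ^ K < (q : ℝ) := by rwa [Real.rpow_natCast] at hqK
  have hfloor : ⌊Real.log x ^ K⌋₊ < q := by
    exact_mod_cast (Nat.floor_le h0).trans_lt hqK'
  exact hpt q hfloor hqQ hqE

/-- (C⁺) `GenericAffineTable` from `stub_tableChowla` and `stub_largeDilatedTableChowla`
(`GenericCore.genericAffineTable_of_tableChowla_of_largeDilations`: small dilations `q ≤ (log x)^{K₀}`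
from `TableChowla` at exponent `C + 4K₀` by positivity of Gram fourth moments; the band from
`largeDilationsCore_of_stub`).  The statement of the core theorem is the body of `GenericAffineTable`
verbatim (definitional). -/
theorem genericAffineTable_of_stubs : GenericAffineTable :=
  Summit.Parity.GeneralizedHardyLittlewood.Theorems.DilatedTableChowla.GenericCore.genericAffineTable_of_tableChowla_of_largeDilations
    stub_tableChowla largeDilationsCore_of_stub

/-! ### §5b Bridges from the registered (unfolded) stubs to the named propositions of §2 -/

/-- (Z1) in named form. -/
theorem smallConductorsZeroFree_of_stub : SmallConductorsZeroFree := by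
  intro K K' K''
  obtain ⟨x₀, h⟩ := stub_smallConductors K K' K''
  refine ⟨x₀, fun x hx d _ hdK => ?_⟩
  intro _ χ s h1 h2 h3
  exact h x hx d χ s hdK h1 h2 h3

/-- (Z2) in named form (classical: a modulus that is not box-zero-free carries a box zero). -/
theorem fewBadConductors_of_stub : FewBadConductors := by
  intro θ K' K''
  obtain ⟨E₀, x₀, h⟩ := stub_fewBadConductors θ K' K''
  refine ⟨E₀, x₀, fun x hx => ?_⟩
  obtain ⟨S, hcard, hbad, hcover⟩ := h x hx
  refine ⟨S, hcard, fun s hs hfree => ?_, fun d hd1 hdθ hnot => ?_⟩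
  · obtain ⟨hne, χ, z, h1, h2, h3, h4⟩ := hbad s hs
    exact (@hfree hne) χ z h1 h2 h3 h4
  · haveI : NeZero d := ⟨by omega⟩
    by_contra hno
    apply hnot
    intro _ χ z h1 h2 h3 h4
    exact hno (hcover d χ z hdθ h1 h2 h3 h4)

/-- (★) in named form. -/
theorem onePointTransfer_of_stub : OnePointTransfer := by
  intro B κ hκ
  obtain ⟨K', K'', x₀, h⟩ := stub_onePointTransfer B κ hκ
  refine ⟨K', K'', x₀, fun x hx q hq1 hq24 hbox => ?_⟩
  intro n hqn hnle _ χ y hy1 hy2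
  refine h x hx q hq1 hq24 (fun n' _ χ' z hqn' hn'le h1 h2 h3 => ?_) n χ y hqn hnle hy1 hy2
  exact hbox n' hqn' hn'le χ' z h1 h2 h3

/-! ### §6 Composition (kernel-checked; `sorry` enters only through the two registered `stub_*` of §5a) -/

theorem five_le_log_of_ge {x : ℝ} (hx : 256 ≤ x) : 5 ≤ Real.log x := by
  have h2 := Real.log_two_gt_d9
  calc (5 : ℝ) ≤ 8 * Real.log 2 := by linarith
    _ = Real.log ((2 : ℝ) ^ 8) := by rw [Real.log_pow]; norm_num
    _ ≤ Real.log x := Real.log_le_log (by norm_num) (by norm_num; linarith)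

/-- THE QUARANTINE ARCHITECTURE, sorry-free: the four named statements imply the crux in its
factored form `lhs ≤ x²/(log x)^C` (stated with `lhs`, so that `DilatedTableChowla_of` below is the
unique declaration whose conclusion is the route decl by name).  Proof: instantiate (C⁺) at exponent
`C+3` (giving `B, κ`), (★) at `B, κ` (giving `K', K''`), (Z2) at `θ = 1` (giving `E₀` and the bad
set `S`), (Z1) at level `K = E₀ + 2κ + (C+5)`; the exceptional set `E` = non-generic `q ≤ x^{δ/2}`
has `Σ_{q∈E} 1/q ≤ (1 + log Q)/(log x)^{C+5}` (`excSet_harmonic_le`), the prover's `E'` has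
`Σ 1/q ≤ (log x)^{-(C+3)}`; on `E ∪ E'` use the trivial bound `q³F ≤ 36x²/q`, off `E ∪ E'` the chain
box-generic ⟹ one-point data (★) ⟹ `q⁴F ≤ x²/(log x)^{C+3}` (C⁺) and `Σ_{q≤Q} 1/q ≤ 1 + log Q ≤ log x`;
each of the three pieces is `≤ x²/(3 (log x)^C)` once `log x ≥ 5`. -/
theorem lhs_bound_of (hZ1 : SmallConductorsZeroFree) (hZ2 : FewBadConductors)
    (hT : OnePointTransfer) (hG : GenericAffineTable) :
    ∀ c : ℤ, c ≠ 0 → ∀ δ : ℝ, 0 < δ → δ ≤ 1 / 12 → ∀ C : ℝ, 0 < C → ∃ x₀ : ℝ, ∀ x : ℝ, x₀ ≤ x →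
      ∀ A : ℝ, x ^ δ ≤ A → A ≤ x ^ (1 / 3 + δ) → ∀ u v : ℕ → ℕ,
        lhs c δ x A u v ≤ x ^ 2 / Real.log x ^ C := by
  intro c hc δ hδ hδ' C hC
  -- (C⁺) at exponent `C + 3`
  obtain ⟨B, κ, hκ, x₁, hx₁⟩ := (genericAffineTable_iff.1 hG) c hc δ hδ hδ' (C + 3) (by linarith)
  -- (★) for these `B, κ`
  obtain ⟨K', K'', x₂, hx₂⟩ := hT B κ hκ
  -- (Z2) with `θ = 1`
  obtain ⟨E₀, x₃, hx₃⟩ := hZ2 1 K' K''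
  -- (Z1) at level `K = E₀ + 2κ + (C + 5)`
  obtain ⟨x₄, hx₄⟩ := hZ1 (E₀ + 2 * κ + (C + 5)) K' K''
  -- growth: `(log x)^κ ≤ x^{1/2}` eventually
  obtain ⟨x₅, hx₅⟩ := eventually_log_rpow_le 1 κ (by norm_num : (0 : ℝ) < 1 / 2)
  refine ⟨max (max (max x₁ x₂) (max x₃ x₄)) (max x₅ 256), fun x hx A hA1 hA2 u v => ?_⟩
  simp only [max_le_iff] at hx
  obtain ⟨⟨⟨hx1, hx2⟩, hx3, hx4⟩, hx5, hx256⟩ := hx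
  have hx1' : 1 ≤ x := by linarith
  have hxpos : 0 < x := by linarith
  have hxgt : 1 < x := by linarith
  have hlog5 : 5 ≤ Real.log x := five_le_log_of_ge hx256
  have hlogpos : 0 < Real.log x := by linarith
  have hL : ∀ r : ℝ, 0 < Real.log x ^ r := fun r => Real.rpow_pos_of_pos hlogpos r
  set Q : ℕ := ⌊x ^ (δ / 2)⌋₊ with hQdef
  have hxd2 : 0 < x ^ (δ / 2) := Real.rpow_pos_of_pos hxpos _
  have hQle : (Q : ℝ) ≤ x ^ (δ / 2) := Nat.floor_le hxd2.le
  have hQ1 : 1 ≤ Q := Nat.le_floor (by simpa using Real.one_le_rpow hx1' (by linarith : 0 ≤ δ / 2))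
  have hQpos : (0 : ℝ) < Q := by exact_mod_cast hQ1
  -- `1 + log Q ≤ log x`
  have hlogQ : Real.log Q ≤ δ / 2 * Real.log x := by
    calc Real.log Q ≤ Real.log (x ^ (δ / 2)) := Real.log_le_log hQpos hQle
      _ = δ / 2 * Real.log x := Real.log_rpow hxpos _
  have hlogQ0 : 0 ≤ Real.log Q := Real.log_natCast_nonneg Q
  have h1logQ : 1 + Real.log Q ≤ Real.log x := by nlinarith
  -- (Z2) data at `x`; (C⁺) data at `x, A, u, v`
  obtain ⟨S, hScard, hSbad, hcover⟩ := hx₃ x hx3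
  obtain ⟨E', hE', hpt⟩ := hx₁ x hx1 A hA1 hA2 u v
  -- growth condition `Q (log x)^κ ≤ x^1`
  have hQκ : (Q : ℝ) * Real.log x ^ κ ≤ x ^ (1 : ℝ) := by
    have h5 : 1 * Real.log x ^ κ ≤ x ^ (1 / 2 : ℝ) := hx₅ x hx5
    calc (Q : ℝ) * Real.log x ^ κ ≤ x ^ (δ / 2) * x ^ (1 / 2 : ℝ) :=
          mul_le_mul hQle (by linarith) (hL κ).le hxd2.le
      _ = x ^ (δ / 2 + 1 / 2) := by rw [← Real.rpow_add hxpos]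
      _ ≤ x ^ (1 : ℝ) := Real.rpow_le_rpow_of_exponent_le hx1' (by linarith)
  -- HARMONIC QUARANTINE of the non-generic dilations
  set E := excSet x K' K'' κ Q with hEdef
  have hE : ∑ q ∈ E, ((q : ℝ))⁻¹ ≤ (1 + Real.log Q) / Real.log x ^ (C + 5) := by
    have h := excSet_harmonic_le (θ := 1) (K := E₀ + 2 * κ + (C + 5)) (Q := Q)
      hxgt hSbad hcover (hx₄ x hx4) hQκ
    refine h.trans ?_
    have hK : Real.log x ^ (E₀ + 2 * κ + (C + 5)) =
        Real.log x ^ E₀ * (Real.log x ^ κ) ^ 2 * Real.log x ^ (C + 5) := by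
      rw [Real.rpow_add hlogpos, Real.rpow_add hlogpos, show (2 : ℝ) * κ = κ * 2 by ring,
        Real.rpow_mul hlogpos.le, Real.rpow_two]
    rw [hK]
    have hS1 : (S.card : ℝ) / Real.log x ^ E₀ ≤ 1 := (div_le_one (hL E₀)).2 hScard
    have hk2 : 0 < (Real.log x ^ κ) ^ 2 := by positivity
    calc (S.card : ℝ) * (Real.log x ^ κ) ^ 2 * (1 + Real.log Q) /
          (Real.log x ^ E₀ * (Real.log x ^ κ) ^ 2 * Real.log x ^ (C + 5))
        = ((S.card : ℝ) / Real.log x ^ E₀) * ((1 + Real.log Q) / Real.log x ^ (C + 5)) := by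
          field_simp
      _ ≤ 1 * ((1 + Real.log Q) / Real.log x ^ (C + 5)) :=
          mul_le_mul_of_nonneg_right hS1 (div_nonneg (by linarith) (hL _).le)
      _ = (1 + Real.log Q) / Real.log x ^ (C + 5) := one_mul _
  -- SPLIT the left-hand side at `E ∪ E'`
  have hsplit := Finset.sum_filter_add_sum_filter_not (Finset.Icc 1 Q) (fun q => q ∈ E ∪ E')
    (fun q => (q : ℝ) ^ 3 * F c x A q (u q) (v q))
  -- (a) exceptional dilations: trivial bound `q³ F ≤ 36 x²/q`
  have hexc : ∑ q ∈ (Finset.Icc 1 Q).filter (fun q => q ∈ E ∪ E'),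
        (q : ℝ) ^ 3 * F c x A q (u q) (v q)
      ≤ 36 * x ^ 2 * (∑ q ∈ E, ((q : ℝ))⁻¹ + ∑ q ∈ E', ((q : ℝ))⁻¹) := by
    have hui := Finset.sum_union_inter (s₁ := E) (s₂ := E') (f := fun q : ℕ => ((q : ℝ))⁻¹)
    have hnn : 0 ≤ ∑ q ∈ E ∩ E', ((q : ℝ))⁻¹ := Finset.sum_nonneg fun q _ => by positivity
    calc ∑ q ∈ (Finset.Icc 1 Q).filter (fun q => q ∈ E ∪ E'), (q : ℝ) ^ 3 * F c x A q (u q) (v q)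
        ≤ ∑ q ∈ (Finset.Icc 1 Q).filter (fun q => q ∈ E ∪ E'), 36 * x ^ 2 * ((q : ℝ))⁻¹ := by
          refine Finset.sum_le_sum fun q hq => ?_
          obtain ⟨hq, -⟩ := Finset.mem_filter.1 hq
          obtain ⟨hq1, hq2⟩ := Finset.mem_Icc.1 hq
          exact term_le_trivial hδ hδ' hx1' hA1 hA2 hq1 hq2 (u q) (v q)
      _ ≤ ∑ q ∈ E ∪ E', 36 * x ^ 2 * ((q : ℝ))⁻¹ :=
          Finset.sum_le_sum_of_subset_of_nonneg (fun q hq => (Finset.mem_filter.1 hq).2)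
            fun q _ _ => by positivity
      _ = 36 * x ^ 2 * ∑ q ∈ E ∪ E', ((q : ℝ))⁻¹ := by rw [Finset.mul_sum]
      _ ≤ 36 * x ^ 2 * (∑ q ∈ E, ((q : ℝ))⁻¹ + ∑ q ∈ E', ((q : ℝ))⁻¹) := by
          gcongr; linarith
  -- (b) generic dilations off `E'`: box-generic ⟹ one-point data (★) ⟹ pointwise bound (C⁺)
  have hgen : ∑ q ∈ (Finset.Icc 1 Q).filter (fun q => ¬ q ∈ E ∪ E'),
        (q : ℝ) ^ 3 * F c x A q (u q) (v q)
      ≤ (1 + Real.log Q) * (x ^ 2 / Real.log x ^ (C + 3)) := by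
    calc ∑ q ∈ (Finset.Icc 1 Q).filter (fun q => ¬ q ∈ E ∪ E'), (q : ℝ) ^ 3 * F c x A q (u q) (v q)
        ≤ ∑ q ∈ (Finset.Icc 1 Q).filter (fun q => ¬ q ∈ E ∪ E'),
            ((q : ℝ))⁻¹ * (x ^ 2 / Real.log x ^ (C + 3)) := by
          refine Finset.sum_le_sum fun q hq => ?_
          obtain ⟨hqI, hqEE⟩ := Finset.mem_filter.1 hq
          obtain ⟨hq1, hq2⟩ := Finset.mem_Icc.1 hqI
          have hqpos : (0 : ℝ) < q := by exact_mod_cast hq1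
          rw [Finset.mem_union, not_or] at hqEE
          obtain ⟨hqE, hqE'⟩ := hqEE
          -- `q ∉ E` means `q` is box-generic
          have hbox : BoxGeneric q x K' K'' κ := by
            by_contra hng
            exact hqE (Finset.mem_filter.2 ⟨hqI, hng⟩)
          -- (★): one-point data at `q` (note `q ≤ x^{δ/2} ≤ x^{1/24}`)
          have hq24 : (q : ℝ) ≤ x ^ (1 / 24 : ℝ) := by
            calc (q : ℝ) ≤ Q := by exact_mod_cast hq2
              _ ≤ x ^ (δ / 2) := hQle
              _ ≤ x ^ (1 / 24 : ℝ) := Real.rpow_le_rpow_of_exponent_le hx1' (by linarith)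
          have hone : OnePointData q x B κ := hx₂ x hx2 q hq1 hq24 hbox
          -- (C⁺): the pointwise bound at the classes `(u q, v q)`
          have hp : (q : ℝ) ^ 4 * F c x A q (u q) (v q) ≤ x ^ 2 / Real.log x ^ (C + 3) :=
            hpt q hq1 hq2 hqE' hone
          calc (q : ℝ) ^ 3 * F c x A q (u q) (v q)
              = ((q : ℝ))⁻¹ * ((q : ℝ) ^ 4 * F c x A q (u q) (v q)) := by field_simp
            _ ≤ ((q : ℝ))⁻¹ * (x ^ 2 / Real.log x ^ (C + 3)) := by gcongr
      _ ≤ ∑ q ∈ Finset.Icc 1 Q, ((q : ℝ))⁻¹ * (x ^ 2 / Real.log x ^ (C + 3)) :=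
          Finset.sum_le_sum_of_subset_of_nonneg (Finset.filter_subset _ _) fun q _ _ => by
            have := hL (C + 3); positivity
      _ = (∑ q ∈ Finset.Icc 1 Q, ((q : ℝ))⁻¹) * (x ^ 2 / Real.log x ^ (C + 3)) := by
          rw [Finset.sum_mul]
      _ ≤ (1 + Real.log Q) * (x ^ 2 / Real.log x ^ (C + 3)) := by
          have := hL (C + 3)
          gcongr; exact harmonic_Icc_le Q
  -- (c) numerics: each of the three pieces is `≤ x² / (3 (log x)^C)`
  have hC0 := hL C
  have hpowC3 : Real.log x ^ (C + 3) = Real.log x ^ C * Real.log x ^ 3 := by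
    rw [Real.rpow_add hlogpos, show (3 : ℝ) = ((3 : ℕ) : ℝ) by norm_num, Real.rpow_natCast]
  have hpowC5 : Real.log x ^ (C + 5) = Real.log x ^ C * Real.log x ^ 5 := by
    rw [Real.rpow_add hlogpos, show (5 : ℝ) = ((5 : ℕ) : ℝ) by norm_num, Real.rpow_natCast]
  -- (c1) the non-generic dilations
  have hexcE : 36 * x ^ 2 * ∑ q ∈ E, ((q : ℝ))⁻¹ ≤ x ^ 2 / (3 * Real.log x ^ C) := by
    calc 36 * x ^ 2 * ∑ q ∈ E, ((q : ℝ))⁻¹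
        ≤ 36 * x ^ 2 * ((1 + Real.log Q) / Real.log x ^ (C + 5)) := by gcongr
      _ ≤ 36 * x ^ 2 * (Real.log x / Real.log x ^ (C + 5)) := by gcongr
      _ = 36 * x ^ 2 / (Real.log x ^ C * Real.log x ^ 4) := by
          rw [hpowC5]; field_simp
      _ ≤ x ^ 2 / (3 * Real.log x ^ C) := by
          rw [div_le_div_iff₀ (by positivity) (by positivity)]
          -- 36 x² · 3 L^C ≤ x² · L^C · L⁴  since  L⁴ ≥ 5⁴ = 625 ≥ 108
          have h4 : (108 : ℝ) ≤ Real.log x ^ 4 := by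
            have : (5 : ℝ) ^ 4 ≤ Real.log x ^ 4 := by gcongr
            norm_num at this
            linarith
          have key : x ^ 2 * Real.log x ^ C * 108 ≤ x ^ 2 * Real.log x ^ C * Real.log x ^ 4 :=
            mul_le_mul_of_nonneg_left h4 (by positivity)
          linarith [key]
  -- (c2) the prover's exceptional set `E'`
  have hexcE' : 36 * x ^ 2 * ∑ q ∈ E', ((q : ℝ))⁻¹ ≤ x ^ 2 / (3 * Real.log x ^ C) := by
    calc 36 * x ^ 2 * ∑ q ∈ E', ((q : ℝ))⁻¹
        ≤ 36 * x ^ 2 * (Real.log x ^ (C + 3))⁻¹ := by gcongr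
      _ = 36 * x ^ 2 / (Real.log x ^ C * Real.log x ^ 3) := by
          rw [hpowC3, div_eq_mul_inv]
      _ ≤ x ^ 2 / (3 * Real.log x ^ C) := by
          rw [div_le_div_iff₀ (by positivity) (by positivity)]
          -- 36 x² · 3 L^C ≤ x² · L^C · L³  since  L³ ≥ 5³ = 125 ≥ 108
          have h3 : (108 : ℝ) ≤ Real.log x ^ 3 := by
            have : (5 : ℝ) ^ 3 ≤ Real.log x ^ 3 := by gcongr
            norm_num at this
            linarith
          have key : x ^ 2 * Real.log x ^ C * 108 ≤ x ^ 2 * Real.log x ^ C * Real.log x ^ 3 :=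
            mul_le_mul_of_nonneg_left h3 (by positivity)
          linarith [key]
  -- (c3) the generic dilations
  have hgen' : (1 + Real.log Q) * (x ^ 2 / Real.log x ^ (C + 3)) ≤ x ^ 2 / (3 * Real.log x ^ C) := by
    rw [hpowC3]
    calc (1 + Real.log Q) * (x ^ 2 / (Real.log x ^ C * Real.log x ^ 3))
        ≤ Real.log x * (x ^ 2 / (Real.log x ^ C * Real.log x ^ 3)) := by gcongr
      _ = x ^ 2 / (Real.log x ^ C * Real.log x ^ 2) := by
          rw [mul_div_assoc', div_eq_div_iff (by positivity) (by positivity)]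
          ring
      _ ≤ x ^ 2 / (3 * Real.log x ^ C) := by
          apply div_le_div_of_nonneg_left (by positivity) (by positivity)
          have h2 : (25 : ℝ) ≤ Real.log x ^ 2 := by
            have : (5 : ℝ) ^ 2 ≤ Real.log x ^ 2 := by gcongr
            norm_num at this
            exact this
          calc 3 * Real.log x ^ C ≤ Real.log x ^ 2 * Real.log x ^ C :=
                mul_le_mul_of_nonneg_right (by linarith) hC0.le
            _ = Real.log x ^ C * Real.log x ^ 2 := by ring
  have hsum : lhs c δ x A u v ≤
      x ^ 2 / (3 * Real.log x ^ C) + x ^ 2 / (3 * Real.log x ^ C) + x ^ 2 / (3 * Real.log x ^ C) := by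
    unfold lhs
    rw [← hQdef, ← hsplit]
    have h36 : 36 * x ^ 2 * (∑ q ∈ E, ((q : ℝ))⁻¹ + ∑ q ∈ E', ((q : ℝ))⁻¹) =
        36 * x ^ 2 * ∑ q ∈ E, ((q : ℝ))⁻¹ + 36 * x ^ 2 * ∑ q ∈ E', ((q : ℝ))⁻¹ := by ring
    linarith [hexc, hgen, hgen', hexcE, hexcE']
  have hfin : x ^ 2 / (3 * Real.log x ^ C) + x ^ 2 / (3 * Real.log x ^ C) +
      x ^ 2 / (3 * Real.log x ^ C) = x ^ 2 / Real.log x ^ C := by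
    field_simp; ring
  linarith

/-- THE SKELETON: the line's quarantine composition concludes the crux
`Summit.Parity.GeneralizedHardyLittlewood.Theses.LiouvilleShiftedTables.DilatedTableChowla` BY NAME
from (Z1), (Z2), (★) (landed theorems) and (C⁺) (`genericAffineTable_of_stubs`).  This declaration
contains no `sorry` of its own; after the c1 reshape `sorry` enters only through the two registered
stubs `stub_tableChowla` (stmt-Parity-14270) and `stub_largeDilatedTableChowla` (stmt-Parity-14839). -/
theorem DilatedTableChowla_of :
    Summit.Parity.GeneralizedHardyLittlewood.Theses.LiouvilleShiftedTables.DilatedTableChowla :=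
  crux_iff_lhs.2 (lhs_bound_of smallConductorsZeroFree_of_stub fewBadConductors_of_stub
    onePointTransfer_of_stub genericAffineTable_of_stubs)

/-- The hypothetical form of the composition — pure logic in the four stub STATEMENTS (an `example`,
so that `DilatedTableChowla_of` stays the unique declaration concluding the crux). -/
example : SmallConductorsZeroFree → FewBadConductors → OnePointTransfer → GenericAffineTable →
    Summit.Parity.GeneralizedHardyLittlewood.Theses.LiouvilleShiftedTables.DilatedTableChowla :=
  fun hZ1 hZ2 hT hG => crux_iff_lhs.2 (lhs_bound_of hZ1 hZ2 hT hG)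

/-- The DIRECT composition through the landed glue of stmt-Parity-14840 / p88402 (an `example`): the
two registered stubs give the crux without the quarantine — which is why this line has no content of
its own left beyond the two items. -/
example : Summit.Parity.GeneralizedHardyLittlewood.Theses.LiouvilleShiftedTables.DilatedTableChowla :=
  Summit.Parity.GeneralizedHardyLittlewood.Theorems.LargeDilatedTableChowla.dilatedTableChowla_of_table_of_item
    stub_tableChowla stub_largeDilatedTableChowla

/-- Conversely the crux gives both registered stubs (an `example`; `p88402`): the stub set is MINIMAL —
no reshape inside this line can replace either stub by something the crux does not already imply. -/
example (h : Summit.Parity.GeneralizedHardyLittlewood.Theses.LiouvilleShiftedTables.DilatedTableChowla) :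
    TableChowla ∧ LargeDilatedTableChowla :=
  Summit.Parity.GeneralizedHardyLittlewood.Theorems.LargeDilatedTableChowla.dilatedTableChowla_iff_table_and_item.1 h

-- audit: the conclusion is the route decl itself
#check (DilatedTableChowla_of : DilatedTableChowla)

/-! ### §7 Tools for the lead, sorry-free: lever (P) — positivity along the divisor lattice

The idea card's first lever, kernel-checked by triage r1-1/r1-2 (`TRIAGE-r1-2-GramMono.lean`,
`Triage2.gramFourthMomentMonotone`; proof reproduced here so that this file is self-contained):
Gram fourth moments are monotone in the row AND column sets (columns: the cross term
`tr(G_T G_D) = ‖M_Tᵀ M_D‖_F²` is a sum of squares — not termwise).  Consequence for the crux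
(`F_le_of_dvd`): the block at dilation `q` is entrywise a sub-block of the block at any divisor
`q' ∣ q` with the same classes, so `F(q,u,v) ≤ F(q',u,v)`; in particular `F(q,u,v) ≤ F(1) =` the
plain table moment, class-sup included.  With (Z1) in hand this lever is no longer NEEDED by the
composition (the generic core covers the small dilations too), but it is the cheapest way for the
(C⁺) prover to dispose of `q ≤ (log x)^{K₀}` from `TableChowla` at exponent `C + 4K₀`, and it is the
reason the route's foreseen `SmallDilations` node has no content of its own. -/

/-- Row monotonicity: dropping rows drops non-negative terms. -/
theorem gram_rows_mono (f : ℕ → ℕ → ℝ) (S S' T : Finset ℕ) (hS : S ⊆ S') :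
    (∑ a ∈ S, ∑ a' ∈ S, (∑ b ∈ T, f a b * f a' b) ^ 2) ≤
      ∑ a ∈ S', ∑ a' ∈ S', (∑ b ∈ T, f a b * f a' b) ^ 2 := by
  calc (∑ a ∈ S, ∑ a' ∈ S, (∑ b ∈ T, f a b * f a' b) ^ 2)
      ≤ ∑ a ∈ S, ∑ a' ∈ S', (∑ b ∈ T, f a b * f a' b) ^ 2 := by
        apply Finset.sum_le_sum
        intro a _
        exact Finset.sum_le_sum_of_subset_of_nonneg hS (fun _ _ _ => sq_nonneg _)
    _ ≤ ∑ a ∈ S', ∑ a' ∈ S', (∑ b ∈ T, f a b * f a' b) ^ 2 :=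
        Finset.sum_le_sum_of_subset_of_nonneg hS
          (fun _ _ _ => Finset.sum_nonneg (fun _ _ => sq_nonneg _))

/-- `tr(G_T G_D) = ‖M_Tᵀ M_D‖_F²`: the cross Gram term is a sum of squares (triage r1-2 `cross_eq`). -/
theorem gram_cross_eq (f : ℕ → ℕ → ℝ) (S T D : Finset ℕ) :
    (∑ a ∈ S, ∑ a' ∈ S, (∑ b ∈ T, f a b * f a' b) * (∑ d ∈ D, f a d * f a' d)) =
      ∑ b ∈ T, ∑ d ∈ D, (∑ a ∈ S, f a b * f a d) ^ 2 := by
  have e1 : ∀ a a', (∑ b ∈ T, f a b * f a' b) * (∑ d ∈ D, f a d * f a' d) =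
      ∑ b ∈ T, ∑ d ∈ D, (f a b * f a d) * (f a' b * f a' d) := by
    intro a a'
    rw [Finset.sum_mul_sum]
    refine Finset.sum_congr rfl fun b _ => Finset.sum_congr rfl fun d _ => ?_
    ring
  have e2 : ∀ b d, (∑ a ∈ S, f a b * f a d) ^ 2 =
      ∑ a ∈ S, ∑ a' ∈ S, (f a b * f a d) * (f a' b * f a' d) := by
    intro b d
    rw [sq, Finset.sum_mul_sum]
  simp_rw [e1, e2]
  calc ∑ a ∈ S, ∑ a' ∈ S, ∑ b ∈ T, ∑ d ∈ D, (f a b * f a d) * (f a' b * f a' d)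
      = ∑ a ∈ S, ∑ b ∈ T, ∑ a' ∈ S, ∑ d ∈ D, (f a b * f a d) * (f a' b * f a' d) := by
        refine Finset.sum_congr rfl fun a _ => ?_
        exact Finset.sum_comm
    _ = ∑ b ∈ T, ∑ a ∈ S, ∑ a' ∈ S, ∑ d ∈ D, (f a b * f a d) * (f a' b * f a' d) :=
        Finset.sum_comm
    _ = ∑ b ∈ T, ∑ a ∈ S, ∑ d ∈ D, ∑ a' ∈ S, (f a b * f a d) * (f a' b * f a' d) := by
        refine Finset.sum_congr rfl fun b _ => Finset.sum_congr rfl fun a _ => ?_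
        exact Finset.sum_comm
    _ = ∑ b ∈ T, ∑ d ∈ D, ∑ a ∈ S, ∑ a' ∈ S, (f a b * f a d) * (f a' b * f a' d) := by
        refine Finset.sum_congr rfl fun b _ => ?_
        exact Finset.sum_comm

/-- Column monotonicity at a fixed row set (the PSD half of (P)). -/
theorem gram_cols_mono (f : ℕ → ℕ → ℝ) (S T T' : Finset ℕ) (hT : T ⊆ T') :
    (∑ a ∈ S, ∑ a' ∈ S, (∑ b ∈ T, f a b * f a' b) ^ 2) ≤
      ∑ a ∈ S, ∑ a' ∈ S, (∑ b ∈ T', f a b * f a' b) ^ 2 := by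
  have hU : T' = T ∪ (T' \ T) := (Finset.union_sdiff_of_subset hT).symm
  rw [hU]
  simp_rw [Finset.sum_union Finset.disjoint_sdiff]
  have hexp : ∀ a a', ((∑ b ∈ T, f a b * f a' b) + ∑ d ∈ T' \ T, f a d * f a' d) ^ 2 =
      (∑ b ∈ T, f a b * f a' b) ^ 2 +
        2 * ((∑ b ∈ T, f a b * f a' b) * (∑ d ∈ T' \ T, f a d * f a' d)) +
        (∑ d ∈ T' \ T, f a d * f a' d) ^ 2 := fun a a' => by ring
  simp_rw [hexp, Finset.sum_add_distrib, ← Finset.mul_sum]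
  have h1 : 0 ≤ ∑ a ∈ S, ∑ a' ∈ S, (∑ b ∈ T, f a b * f a' b) * (∑ d ∈ T' \ T, f a d * f a' d) := by
    rw [gram_cross_eq]
    exact Finset.sum_nonneg (fun _ _ => Finset.sum_nonneg (fun _ _ => sq_nonneg _))
  have h2 : 0 ≤ ∑ a ∈ S, ∑ a' ∈ S, (∑ d ∈ T' \ T, f a d * f a' d) ^ 2 :=
    Finset.sum_nonneg (fun _ _ => Finset.sum_nonneg (fun _ _ => sq_nonneg _))
  linarith

/-- LEVER (P): `GramFourthMomentMonotone` of the idea card, sorry-free. -/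
theorem gram_mono (f : ℕ → ℕ → ℝ) (S S' T T' : Finset ℕ) (hS : S ⊆ S') (hT : T ⊆ T') :
    (∑ a ∈ S, ∑ a' ∈ S, (∑ b ∈ T, f a b * f a' b) ^ 2) ≤
      ∑ a ∈ S', ∑ a' ∈ S', (∑ b ∈ T', f a b * f a' b) ^ 2 :=
  le_trans (gram_rows_mono f S S' T hS) (gram_cols_mono f S' T T' hT)

theorem rows_subset_of_dvd (A : ℝ) {q q' : ℕ} (h : q' ∣ q) (u : ℕ) : rows A q u ⊆ rows A q' u := by
  intro a ha
  simp only [rows, Finset.mem_filter] at ha ⊢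
  exact ⟨ha.1, Nat.ModEq.of_dvd h ha.2⟩

theorem cols_subset_of_dvd (x A : ℝ) {q q' : ℕ} (h : q' ∣ q) (v : ℕ) :
    cols x A q v ⊆ cols x A q' v := by
  intro b hb
  simp only [cols, Finset.mem_filter] at hb ⊢
  exact ⟨hb.1, Nat.ModEq.of_dvd h hb.2⟩

/-- POSITIVITY ALONG DIVISORS: `F(q,u,v) ≤ F(q',u,v)` for `q' ∣ q` (same class representatives);
`q' = 1` gives block ≤ plain table, uniformly in the classes. -/
theorem F_le_of_dvd (c : ℤ) (x A : ℝ) {q q' : ℕ} (h : q' ∣ q) (u v : ℕ) :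
    F c x A q u v ≤ F c x A q' u v := by
  unfold F S
  exact gram_mono (fun a b => L ((a : ℤ) * b + c)) _ _ _ _ (rows_subset_of_dvd A h u)
    (cols_subset_of_dvd x A h v)


end Summit.Parity.GeneralizedHardyLittlewood.Cruxes.DilatedTableChowla.PositivityQuarantine

end
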